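import Literature.MathematicalPhysics.QuantumFieldTheory.Balaban1983to89.B12GaugeGen48

/-!
# Bałaban CMP 109 (1987) §4 pp. 285–289: the Ward–Takahashi REDUCTION (4.21), (4.24)–(4.29), (4.30)–(4.31) of the
marginal terms `⟨𝐄⁽⁴⁾, δB, B, B, B⟩`, `⟨𝐄⁽³⁾, δB, B, B⟩` of (4.20) to `𝐄⁽²⁾`-terms — EXACT identities, pointwise in
the distinguished point `x`, from (4.15)₁,₂,₃ at `B = 0`, with every «+ (the irrelevant terms)» of print made
EXPLICIT (eleven named remainder terms for (4.29), six for (4.31), each carrying a factor `B − B(x)`, resp.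
`B − B(x) − B(·, x)` or two factors `B(·, x)`)

CITATION HEADER (lean-in-tree rule 2026-08-18).
* Source: T. Bałaban, "Renormalization group approach to lattice gauge field theories. I. Generation of effective
  actions in a small field approximation and a coupling constant renormalization in four dimensions", Commun. Math.
  Phys. **109** (1987) 249–301, doi:10.1007/bf01215223 [Balaban1987RG1] (cell paper B12; held:
  `paper:balaban1987-cmp109-rg-i-small-field`; PDF page = journal page − 248), §4 pp. 285–289, displays
  (4.20)–(4.31) and the sentences between them.  The sentences and displays of pp. 285, 286, 287, 288, 289 quoted
  below were READ AS IMAGES by the author of this file on the 300-dpi renders of the audit cell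
  (`HOME/b2b-balaban-ref1/pages/1987-cmp109-rg-I-small-field/…-p037-x2.png` = p. 285, `…-p038-x2.png` = p. 286,
  `…-p039-x2.png` = p. 287, `…-p040-x2.png` = p. 288, `…-p041-x2.png` = p. 289; HOME = the cell folder
  `run/shared/lean/pub/pub-balaban/`), and agree with the lineage transcript `HOME/b2b-balaban-b03/B12s-transcript.md`
  (ll. 600–790); (4.15) of p. 284 is quoted as in the header of the lineage's `…B12WardThird415` (whose author read
  `…-p036-x2.png`); inside quotation marks nothing is altered.  Audit cell `pub-balaban`, unit `b2b-balaban-b03-g26`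
  (PAPER SUB-CELL B03 → B12 §§2–5 lineage, gen 26), node B12-WT-REDUCTION-429.  Imports only the lineage's own accepted
  module `…B12GaugeGen48` (gen 25; nothing of it is used by name — the import keeps the lineage chain linear);
  through it, BY NAME: `…B12WardThird415` (gen 24: (4.15)₃ at `B = 0` built from a bracket
  `fourth_chart_apply_grad_eq_zero_of_bracket`, the slot symmetries of `D³f` `fderiv_fderiv_fderiv_apply_swap_left`,
  `…_swap_right`, `contDiffAt_three_comp_chart`), `…B12Schur433` (gen 23: the symmetry of the chart Hessian
  `hessian_chart_symm`), `…B12WardSecond415` (gen 22: (4.15)₂ at `B = 0` `third_chart_apply_grad_eq_zero_of_bracket`),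
  `…B12Semisimple414` (gen 21: (4.14) ⇒ (4.15)₁ at `B = 0` `hessian_chart_apply_grad_eq_zero`, perfectness
  `span_commutatorSet_eq_top_of_isSemisimple`), and Mathlib (`NormedSpace.exp`, `LinearMap.mk₂`, the tactic
  `linear_combination (norm := module)`); modifies nothing.
* Statements reproduced (verbatim; `[…]` marks an omission by the author of this file, `[sic]` a misprint of print).
  p. 285 [PDF 37]: *"We begin the analysis of (4.6) introducing simpler notations. We drop the superscript (j) in
  (4.6), and denote (δⁿ/δBⁿ)𝐄^{(j)}(X, U_j(□₀, 1)) = 𝐄^{(n)}(X), or simply 𝐄^{(n)}, (4.19) hence 𝐄^{(n)} is a ⊗ⁿ𝔤-valued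
  function 𝐄^{(n)}_{μ₁,…,μ_n}(x₁, …, x_n) defined on a neighborhood of □̃⁴ in the unit lattice T₁^{(j)}, and (4.6) =
  Σ_{n=2}^{4} (1/(n−1)!) ⟨𝐄^{(n)}, δB, ⊗^{n−1} B⟩. (4.20) Let us consider the third term in the above sum. We apply the
  same method which was used in [7], see especially (3.25)–(3.32) [7]. We write ⟨𝐄^{(4)}, δB, ⊗³B⟩ =
  Σ_{(μ,x),…,(μ₃,x₃)} ⟨𝐄^{(4)}_{μ,μ₁,μ₂,μ₃}(x, x₁, x₂, x₃), δB_μ(x), B_{μ₁}(x₁), B_{μ₂}(x₂), B_{μ₃}(x)⟩ +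
  Σ_{(μ,x),…,(μ₃,x₃)} ⟨𝐄^{(4)}_{μ,μ₁,μ₂,μ₃}(x, x₁, x₂, x₃), δB_μ(x), B_{μ₁}(x₁), B_{μ₂}(x₂), (∂B_{μ₃})(Γ_{x,x₃})⟩.
  (4.21)"*.  p. 286 [PDF 38]: *"Because of the bound (4.17) the second term on the right-hand side above should have
  a bound of the form (3.35). […]"* (4.22) *"hence this sum in (4.21) represents an irrelevant term. […] Consider now
  the first sum in (4.21). The last factor B_{μ₃}(x) is constant as a function of x₃, and we have B_{μ₃}(x) =
  (∂_{μ₃}λ_x)(x₃), λ_x(x₃) = Σ_{ν=1}^{4} (x_{3,ν} − x_ν)B_ν(x). (4.23) The first sum can be written as ⟨𝐄^{(4)}, δB,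
  B, B, ∂λ_x⟩, where we have indicated the dependence on x explicitly. We apply the third identity in (4.15) taking
  into acount [sic] the special role of the first variable x. It is simplest to differentiate this identity with
  respect to B₁, take B₂ = B₃ = B, λ = λ_x, and then multiply by δB(x) and sum over x."*  p. 287 [PDF 39]: *"We get
  ⟨𝐄^{(4)}, δB, B, B, ∂λ_x⟩ = 2⟨𝐄^{(3)}, δB, B, i[λ_x, B] − ½i[B, ∂λ_x]⟩ + ⟨𝐄^{(3)}, i[λ_x, δB] − ½i[δB, ∂λ_x], B, B⟩ −
  2⟨𝐄^{(2)}, δB, k₂(iad_B)²∂λ_x⟩ − 2⟨𝐄^{(2)}, k₂{iad_B, iad_{δB}}∂λ_x, B⟩. (4.24) Now we analyze successively all the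
  terms on the right-hand side. For the last term we have as in (4.21), ⟨𝐄^{(2)}, {iad_B, iad_{δB}}∂λ_x, B⟩ =
  Σ_{(μ,x),(μ₁,x₁)} ⟨𝐄^{(2)}_{μ,μ₁}(x, x₁), {iad_{B_μ(x)}, iad_{δB_μ(x)}}B_μ(x), B_{μ₁}(x)⟩ + Σ_{(μ,x),(μ₁,x₁)}
  ⟨𝐄^{(2)}_{μ,μ₁}(x, x₁), {iad_{B_μ(x)}, iad_{δB_μ(x)}}B_μ(x), (∂B_{μ₁})(Γ_{x,x₁})⟩. (4.25) In the first sum above we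
  write again B_{μ₁}(x) = (∂_{μ₁}λ_x)(x₁), and by the first identity in (4.15) this sum equals 0. The second sum can be
  bounded as in (4.22), hence it is irrelevant. The second function in the term before the last is equal to
  k₂(iad_{B_{μ₁}(x₁)})²B_{μ₁}(x) = k₂ iad_{B_{μ₁}(x₁)} i[B_{μ₁}(x₁), B_{μ₁}(x)] = k₂ iad_{B_{μ₁}(x₁)} i[(∂B_{μ₁})(Γ_{x,x₁}),
  B_{μ₁}(x)], hence this term is irrelevant also. Consider the second term on the right-hand side in (4.24). The
  first function in it is equal to −1/2i[δB_μ(x), B_μ(x)], because λ_x(x) = 0. We apply again the same procedure as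
  in (4.21), or (4.25), and it yields −½⟨𝐄^{(3)}, i[δB, B], B, B⟩ = −½⟨𝐄^{(3)}, i[δB, B], B, ∂λ_x⟩ + (the irrelevant
  term) = −½⟨𝐄^{(2)}, i[δB, B], i[λ_x, B] − ½i[B, ∂λ_x]⟩ − ½⟨𝐄^{(2)}, i[λ_x, i[δB, B]] − ½i[i[δB, B], ∂λ_x], B⟩ + (the
  irrelevant term) = −½⟨𝐄^{(2)}, i[δB, B], i[λ_x, B]⟩ + ¼⟨𝐄^{(2)}, i[i[δB, B], B], B⟩ + (the irrelevant terms), (4.26)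
  where we have used again the equalities i[B_{μ₁}(x₁), (∂λ_x)_{μ₁}(x₁)] = i[B_{μ₁}(x₁), B_{μ₁}(x)] =
  i[(∂B_{μ₁})(Γ_{x,x₁}), B_{μ₁}(x)], λ_x(x) = 0. The second term on the right-hand side of the last equality in (4.26)
  is treated as in (4.25), hence it is irrelevant and we obtain −½⟨𝐄^{(3)}, i[δB, B], B, B⟩ = −½⟨𝐄^{(2)}, i[δB, B],
  i[λ_x, B]⟩ + (the irrelevant terms). (4.27) Finally consider the first term on the right-hand side of (4.24). This
  term with the function −1/2i[B, ∂λ_x] is irrelevant, by the equality written after (4.26). We apply"* p. 288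
  [PDF 40]: *"the procedure in (4.21) to the term with i[λ_x, B] 2⟨𝐄^{(3)}, δB, i[λ_x, B], B⟩ = 2⟨𝐄^{(3)}, δB,
  i[λ_x, B], ∂λ_x⟩ + (the irrelevant term) = 2⟨𝐄^{(2)}, δB, i[λ_x, i[λ_x, B]] − ½i[i[λ_x, B], ∂λ_x]⟩ + 2⟨𝐄^{(2)},
  i[λ_x, δB] − ½i[δB, ∂λ_x], i[λ_x, B]⟩ + (the irrelevant term) = 2⟨𝐄^{(2)}, δB, i[λ_x, i[λ_x, B]]⟩ − ⟨𝐄^{(2)}, δB,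
  i[i[λ_x, B], ∂λ_x]⟩ − ⟨𝐄^{(2)}, i[δB, B], i[λ_x, B]⟩ + (the irrelevant term). (4.28) We can still simplify
  expressions in the last equalities in (4.27), (4.28), replacing all fields B by their values at the point x. The
  difference B(·) − B(x) = (∂B)(Γ_{x,·}) gives rise to irrelevant terms. Thus the equalities (4.21), (4.24), and the
  simplified equalities (4.27), (4.28) yield ⟨𝐄^{(4)}, δB, ⊗³B⟩ = 2⟨𝐄^{(2)}, δB, i[λ_x, i[λ_x, B(x)]]⟩ − ⟨𝐄^{(2)}, δB,
  i[i[λ_x, B(x)], ∂λ_x]⟩ − 3/2⟨𝐄^{(2)}, i[δB, B], i[λ_x, B(x)]⟩ + (the irrelevant terms). (4.29) Let us consider now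
  the second term in the sum (4.20). Again, we apply the procedure in (4.21), but we expand the last factor up to
  second order around the point x. We have the following Taylor's formula on a unit lattice, analogous to the
  formula (3.10) [7] f(y) = f(x) + Σ_{μ=1}^{d} (y_μ − x_μ)(∂_μ f)(x) + […: a triple sum, over μ, over
  x′ ∈ [Γ_{x,y}[_μ and over the bonds b of a contour at x′, of (∂∂_μ f)(b)], (4.30) where [Γ_{x,y}[_μ denotes the
  part of the contour Γ_{x,y} parallel to the μ-th axis, including the initial point and excluding the final point.
  This formula is applied to the function B_{μ₃}(x₃) at y = x₃. By (4.18) the last term on the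
  right-hand side can be estimated by ½|Γ_{x,x₃}|²α₁(Lʲη)^{2+β} with a positive β. For the expression ⟨𝐄^{(3)}, B, B,
  B^{(2)}⟩ [sic: ⟨𝐄^{(3)}, δB, B, B^{(2)}⟩], with this last term inserted in the place of B^{(2)}, it implies the
  bound (4.22) with the power 4 + β instead of 5 in the last factor. Hence this is an irrelevant term. Let us denote
  B_{μ₃}(x₃, x) = Σ_{ν=1}^{4} (x_{3,ν} − x_ν)(∂_ν B_{μ₃})(x)."*  p. 289 [PDF 41]: *"We have ⟨𝐄^{(3)}, δB, ⊗²B⟩ =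
  ⟨𝐄^{(3)}, δB, B, ∂λ_x⟩ + ⟨𝐄^{(3)}, δB, B, B(·, x)⟩ + (the irrelevant term) = ⟨𝐄^{(2)}, δB, i[λ_x, B] − ½i[B, ∂λ_x]⟩
  − ½⟨𝐄^{(2)}, i[δB, B], B⟩ + ⟨𝐄^{(3)}, δB, B(·, x), ∂λ_x⟩ + (the irrelevant term) = ⟨𝐄^{(2)}, δB, i[λ_x, B]⟩ −
  ½⟨𝐄^{(2)}, δB, i[B, B(x)]⟩ − ½⟨𝐄^{(2)}, i[δB, B], B(·, x)⟩ + ⟨𝐄², δB, i[λ_x, B(·, x)] − ½i[B(·, x), ∂λ_x]⟩ −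
  ½⟨𝐄^{(2)}, i[δB, B], B(·, x)⟩ + (the irrelevant terms) = ⟨𝐄^{(2)}, δB, i[λ_x, B(x)]⟩ + 2⟨𝐄^{(2)}, δB, i[λ_x,
  B(·, x)]⟩ − ⟨𝐄^{(2)}, δB, i[B(·, x), B(x)]⟩ − ⟨𝐄^{(2)}, i[δB, B], B(·, x)⟩ + (the irrelevant terms). (4.31) Here, in
  the last equality, all fields and their derivatives are taken at the point x. Thus we have reduced the analysis of
  the sum in (4.20) to the expression involving the functions 𝐄^{(2)} only."*  And p. 284 [PDF 36], (4.15), as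
  quoted by `…B12WardThird415`: *"⟨(δ²/δB²)𝐄(1), B₁, ∂λ⟩ = 0, ⟨(δ³/δB³)𝐄(1), B₁, B₂, ∂λ⟩ − ⟨(δ²/δB²)𝐄(1), B₁,
  i[λ₋, B₂] − ½i[B₂, ∂λ]⟩ − (B₁↔B₂) = 0, ⟨(δ⁴/δB⁴)𝐄(1), B₁,B₂,B₃, ∂λ⟩ − ⟨(δ³/δB³)𝐄(1), B₁,B₂, i[λ₋,B₃] −
  ½i[B₃,∂λ]⟩ − (B₃↔B₂) − (B₃↔B₁) + ⟨(δ²/δB²)𝐄(1), B₁, k₂{iad_{B₂}, iad_{B₃}}∂λ⟩ + (B₁↔B₂) + (B₁↔B₃) = 0, (4.15)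
  for an arbitrary gauge function λ, and arbitrary gauge fields B₁, B₂, B₃."*
* Dictionary print → Lean (the only modelling choices; all bookkeeping, no analysis).  (i) POINTWISE-IN-`x` READING:
  print's `⟨𝐄^{(n)}, δB, …⟩` sums over the bond `(μ, x)` of `δB`, and every identity of pp. 286–289 is derived «taking
  into acount the special role of the first variable x» with the gauge function `λ_x` of that `x`; here `x : T` is
  FIXED and `δB` is a field supported on the bonds issuing from `x` (`hδ : y ≠ x → δB_ν(y) = 0`) — print's displays
  are the sums over `x` of the identities below (linear in `δB`), the re-summation is NOT written out.  (ii) print's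
  `𝐄^{(2)}, 𝐄^{(3)}, 𝐄^{(4)}` ↦ continuous multilinear towers `E2, E3, E4` on the space `Λ → T → V` of `𝔤`-valued
  fields; in the ABSTRACT part (§§2–3) ANY towers with the slot symmetries `hs2`, `hs3l`, `hs3r` that derivatives
  have (`T` is an arbitrary type there — no lattice structure is used), in the CHART part (§4) the second, third and
  fourth Fréchet derivatives at `B = 0` of `f(B) = ℰ(exp ρB)` exactly as in gens 21–24 (`(δᵏ/δBᵏ)𝐄(1)`; bonds
  `(x, x + e_ν)` of a finite additive group `T`, shifts `e : Λ → T`, ambient algebra `𝔄` ⊃ `ρ(V)`, `ρ : V →L[ℝ] 𝔄`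
  absorbing every factor `i` of print, the functional `ℰ : (Λ → T → 𝔄) → F` `C⁴` at `1` — print: analytic — and
  gauge invariant (4.7) near `1`; the symmetries are then theorems of gens 23/24).  (iii) `i[·, ·]`, `iad` ↦ an
  ℝ-bilinear `br : V →ₗ[ℝ] V →ₗ[ℝ] V` with `hself : br a a = 0` (ONLY bilinearity and alternation are used — no
  Jacobi identity); in §4 represented by the commutator (`hbr : ρ(br a b) = ρa ρb − ρb ρa`) or taken to be the Lie
  bracket of a finite-dimensional semisimple real Lie algebra `𝔤 ≃ V` (`eV`, `hρ`; `…_of_isSemisimple`).  (iv) `λ_x`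
  ↦ `lam : T → V` with `hlam : lam x = 0` («λ_x(x) = 0» is the ONLY property of `λ_x` used); the value `B(x)` (print's
  constant field `B_{μ₁}(x)` in the slot of `x₁`) ↦ a field `c` with `hB : B_ν(x) = c_ν(x)`; (4.23) `B(x) = ∂λ_x` ↦ in
  §§2–3 the three Ward–Takahashi identities are HYPOTHESES `h1`, `h2`, `h3` = (4.15)₁, (4.15)₂, (4.15)₃ at `B = 0` in
  exactly the shapes proved by gens 21, 22, 24, with `∂λ` replaced by `c`; in §4 `hc : λ(y + e_ν) − λ(y) = c_ν(y)`
  does this replacement.  MODEL NOTE on (4.23): print's `λ_x(x₃) = Σ_ν (x_{3,ν} − x_ν)B_ν(x)` is an affine function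
  on the unit lattice `⊂ ℤ⁴` whose lattice gradient is the CONSTANT field `B(x)`; on the finite torus `T` of the chart
  part a constant lattice gradient vanishes, so there `c = ∂λ_x` is not literally constant: the identities are proved
  for EVERY pair `(λ_x, c = ∂λ_x)` with `λ_x(x) = 0`, `c(x) = B(x)`, which is all print uses of (4.23); print's
  affine `λ_x` itself is realised in `eq423_affine` on `T = Λ → ℤ` (to which the abstract §§2–3 apply verbatim).
  (v) `B(·, x)` (the linear Taylor term of (4.30)) ↦ an ARBITRARY field `ℓ` (no property of it is used, not even
  `B(x, x) = 0`); `B − B(x) = (∂B)(Γ_{x,·})` ↦ `B − c`; the second-order Taylor remainder `B^{(2)}` ↦ `B − c − ℓ`.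
  (vi) «(the irrelevant term(s))» ↦ EXPLICIT REMAINDERS: each displayed «+ (the irrelevant term(s))» becomes a named
  finite sum of `E`-terms, every one of which carries a factor `B − c` (in (4.29)), resp. `B − c − ℓ` or two factors
  `ℓ` (in (4.31)); their SMALLNESS — (4.17), (4.18), (4.22) and «can be bounded as in (4.22)» — is print's analysis
  and is NOT touched here.  (vii) `k₂ = 1/12` (gens 22, 24, 25), written `(12 : ℝ)⁻¹`; `{iad_B, iad_{δB}}` in
  print's order `br B (br δB ·) + br δB (br B ·)`.  The module is DEFINITION-FREE.
* The mathematics (print's, with the dropped terms kept): linearity of `E2, E3, E4` in each slot, the slot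
  symmetries, bilinearity and alternation of the bracket (so `[B, ∂λ_x] = [B − B(x), B(x)]`, `[B(x), B(x)] = 0`), the
  one-site facts `i[λ_x, δB] − ½i[δB, ∂λ_x] = −½i[δB, B]` («because λ_x(x) = 0») for `δB` and for the one-site
  composite fields `i[δB, B]`, `k₂{iad_B, iad_{δB}}∂λ_x`, `i[i[δB, B], B]`, and the three identities (4.15) at the
  test fields print names; the final step of each display is ONE linear combination over the module `F`
  (`linear_combination (norm := module)`), whose coefficients are print's `2, 1, −2, −2` (4.24), `−½, ¼` (4.26),
  `2, −1, −1` (4.28), `2, −1, −3/2` (4.29), `1, 2, −1, −1` (4.31).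

WHAT IS PROVED (kernel-checked, no `sorry`, standard axioms, NO definitions; every analytic input a NAMED HYPOTHESIS):
* §1 [folklore] `kappa_oneSite` (print p. 287: «The first function in it is equal to −1/2 i[δB_μ(x), B_μ(x)], because
  λ_x(x) = 0», as an identity of fields, for any one-site `δ`), `oneSite_br`, `eq423_affine` (print's (4.23) on
  `ℤ^Λ`: `λ_x(x) = 0` and `∂λ_x = B(x)` constant).
* §2 ABSTRACT (4.21)–(4.29), for towers `E2, E3, E4`, a bracket `br`, a point `x`, `λ_x` with `λ_x(x) = 0`, a
  one-site `δB`, fields `B`, `c` with `B(x) = c(x)`, under `h1`/`h2`/`h3` = (4.15)₁,₂,₃ (with `∂λ ↦ c`):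
  `eq421` (the split of (4.21), fourth slot `B = c + (B − c)`); `eq424` (**(4.24)** with print's coefficients and
  slot orders, the second term with print's un-simplified first function `i[λ_x, δB] − ½i[δB, ∂λ_x]`);
  `eq425` (**(4.25)** and the sentence after it: `⟨E2, q'', B⟩ = ⟨E2, q'', B − c⟩` by (4.15)₁); `eq_beforeLast`
  (the «term before the last»: `k₂(iad_B)²c = k₂ iad_B i[B − c, c]` inside `E2`); `eq427` (**(4.26)–(4.27)** EXACT:
  `−½⟨E3, i[δB,B], B, B⟩ = −½⟨E2, i[δB,B], i[λ_x,B]⟩ + R₄ + R₅ + R₆`); `eq428` (**(4.28)** with the preceding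
  sentence, EXACT: `2⟨E3, δB, B, i[λ_x,B] − ½i[B,c]⟩ = 2⟨E2, δB, i[λ_x,i[λ_x,B]]⟩ − ⟨E2, δB, i[i[λ_x,B],c]⟩ −
  ⟨E2, i[δB,B], i[λ_x,B]⟩ + R₇ + R₈`); `eq429` (**(4.29)** EXACT: `⟨E4, δB, B, B, B⟩ = 2⟨E2, δB,
  i[λ_x,i[λ_x,c]]⟩ − ⟨E2, δB, i[i[λ_x,c],c]⟩ − (3/2)⟨E2, i[δB,B], i[λ_x,c]⟩ + (R₁ + ⋯ + R₁₁)` with `R₁ = ⟨E4, δB, B,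
  B, B − c⟩` [(4.21)/(4.22)], `R₂ = −2⟨E2, q'', B − c⟩` [(4.25), second sum], `R₃ = −2⟨E2, δB, k₂ iad_B i[B − c,
  c]⟩` [«the term before the last»], `R₄ = −½⟨E3, i[δB,B], B, B − c⟩`, `R₅ = ¼⟨E2, i[δB,B], i[B − c, c]⟩`,
  `R₆ = ¼⟨E2, i[i[δB,B],B], B − c⟩` [(4.26)–(4.27)], `R₇ = −⟨E3, δB, B, i[B − c, c]⟩`, `R₈ = 2⟨E3, δB, i[λ_x,B],
  B − c⟩` [(4.28)], `R₉ = 2⟨E2, δB, i[λ_x,i[λ_x,B − c]]⟩`, `R₁₀ = −⟨E2, δB, i[i[λ_x,B − c],c]⟩`, `R₁₁ = −(3/2)⟨E2,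
  i[δB,B], i[λ_x,B − c]⟩` [«replacing all fields B by their values at the point x»]); `eq429_atPoint` (the identity
  at `B = B(x)`, no remainder: `⟨E4, δB, c, c, c⟩ = 2⟨E2, δB, i[λ_x,i[λ_x,c]]⟩ − ⟨E2, δB, i[i[λ_x,c],c]⟩ −
  (3/2)⟨E2, i[δB,c], i[λ_x,c]⟩`, proved directly — needs `h1`, `h2`, `h3`).
* §3 ABSTRACT (4.30)–(4.31) (needs `h1`, `h2` only, `E3` symmetric in its last two slots): `eq430_split` (third slot
  `B = c + ℓ + (B − c − ℓ)`), `eq431` (**(4.31)** EXACT: `⟨E3, δB, B, B⟩ = ⟨E2, δB, i[λ_x,c]⟩ + 2⟨E2, δB, i[λ_x,ℓ]⟩ −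
  ⟨E2, δB, i[ℓ,c]⟩ − ⟨E2, i[δB,B], ℓ⟩ + (S₁ + ⋯ + S₆)`, `S₁ = ⟨E3, δB, B, B − c − ℓ⟩` [(4.30) remainder, line 1],
  `S₂ = ⟨E3, δB, ℓ, ℓ⟩`, `S₃ = ⟨E3, δB, B − c − ℓ, ℓ⟩` [line 1 → 2], `S₄ = −½⟨E2, i[δB,B], B − c − ℓ⟩`, `S₅ = ⟨E2,
  δB, i[λ_x, B − c − ℓ]⟩`, `S₆ = −½⟨E2, δB, i[B − c − ℓ, c]⟩` [lines 2 → 4]), `eq431_atPoint` (`ℓ = 0`, `B = c`: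
  `⟨E3, δB, c, c⟩ = ⟨E2, δB, i[λ_x, c]⟩`).
* §4 IN THE CHART of gens 21–24 (`f(B) = ℰ(exp ρB)`, `(δᵏ/δBᵏ)𝐄(1) = Dᵏf(0)`), the hypotheses `hs2`, `hs3l`, `hs3r`,
  `h1`, `h2`, `h3` DISCHARGED BY NAME from (4.7), «The group G is semisimple» and `C³`/`C⁴`-smoothness:
  `wt12_chart_of_bracket`, `wt_chart_of_bracket` ((4.15)₁,₂ resp. (4.15)₁,₂,₃ at `B = 0` in the shapes `h1`, `h2`,
  `h3`); `eq429_chart_of_bracket` (`C⁴`), `eq431_chart_of_bracket` (`C³`) (any `ρ`-compatible alternating bilinear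
  `br`, perfectness `hspan`); `eq429_chart_of_isSemisimple`, `eq429_atPoint_chart_of_isSemisimple`,
  `eq431_chart_of_isSemisimple` (`𝔤` finite-dimensional semisimple, `ρ` a representation: every hypothesis of §§2–3
  discharged except the analytic ones, (4.7) near `1` and `C⁴` resp. `C³` at `1`).

WHAT IS NOT PROVED HERE (and not claimed): ANY bound — (4.17), (4.18), (4.22), «can be bounded as in (4.22)», i.e.
the irrelevance of `R₁, …, R₁₁`, `S₁, …, S₆` (print's analysis of the kernels `𝐄^{(n)}(x, x₁, …)` and their tree
decay); the summation over `x` and print's `⟨·, ·⟩` pairing with kernels; the Taylor formula (4.30) itself (here `ℓ`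
and `B − c − ℓ` are just names — nothing about `B(·, x)` is used or proved); (4.23) on the finite torus (see the MODEL
NOTE; `eq423_affine` is on `ℤ^Λ`); (4.32)–(4.34) — the Schur step and the assembled table are the lineage's
`…B12Schur433` (gen 23) and `…B12Marginal444` (gen 8, whose header lists «NOT PROVED HERE: the Ward–Takahashi
manipulations (4.21)–(4.31)»: the present module supplies them, but NO by-name bridge to gen 8's scalar-kernel
dictionary `pairE`/`rhs429`/`rhs431` is built here); anything AWAY from `B = 0`, the extension `G → G^c`, the
existence / analyticity / gauge invariance of `𝐄^{(j)}` (B12 §§2–3); nothing about B13 or the continuum limit.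

KERNEL FINDINGS (information about print, not objections): (α) (4.24)–(4.29) and (4.30)–(4.31) are EXACT identities
modulo the listed terms — print's coefficients `2, 1, −2, −2` / `−½, ¼` / `2, −1, −1` / `2, −1, −3/2` / `1, 2, −1, −1`
are confirmed by the kernel as the unique closing linear combinations; (β) what the reduction uses of the Lie
algebra is bilinearity and `[a, a] = 0` only (no Jacobi identity, and semisimplicity only through (4.15)₁,₂), of
`λ_x` only `λ_x(x) = 0`, of `B(·, x)` nothing; (γ) the census of dropped terms: between the first and the second
line of (4.31) print's «(the irrelevant term)» absorbs, besides the `B^{(2)}`-terms, the term `⟨𝐄^{(3)}, δB,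
B(·, x), B(·, x)⟩` (`S₂`), which carries no second-order Taylor remainder but TWO first-order factors — irrelevant
by (4.17)² · |Γ_{x,x₃}|² rather than by (4.18); recorded as a precision of what «irrelevant» covers there; (δ) [sic]
p. 288 «⟨𝐄^{(3)}, B, B, B^{(2)}⟩» for `⟨𝐄^{(3)}, δB, B, B^{(2)}⟩`, p. 286 «acount».

HONEST FRAMING: value = the last hand-certified algebraic link of B12 §4 — the chain (4.21) → (4.24) → (4.25)–(4.28)
→ (4.29) and (4.30) → (4.31) that carries the marginal terms of (4.20) from the Ward–Takahashi identities (gens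
21/22/24) to the `𝐄^{(2)}`-expressions that (4.32)–(4.34) (gens 23/8) then evaluate — is now kernel-checked as a
set of exact identities, and the analytic seats get the precise finite LIST of terms print calls irrelevant.  NOT
summit progress: bookkeeping of printed displays; every analytic statement remains a hypothesis.
-/

namespace Literature.MathematicalPhysics.QuantumFieldTheory.Balaban1983to89.B12WTReduction429

open Literature.MathematicalPhysics.QuantumFieldTheory.Balaban1983to89.B12Semisimple414 (hessian_chart_apply_grad_eq_zero
  span_commutatorSet_eq_top_of_isSemisimple)
open Literature.MathematicalPhysics.QuantumFieldTheory.Balaban1983to89.B12WardSecond415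
  (third_chart_apply_grad_eq_zero_of_bracket)
open Literature.MathematicalPhysics.QuantumFieldTheory.Balaban1983to89.B12Schur433 (hessian_chart_symm)
open Literature.MathematicalPhysics.QuantumFieldTheory.Balaban1983to89.B12WardThird415
  (fourth_chart_apply_grad_eq_zero_of_bracket fderiv_fderiv_fderiv_apply_swap_left fderiv_fderiv_fderiv_apply_swap_right
  contDiffAt_three_comp_chart)
open NormedSpace (exp)
open Filter
open _root_.Topology

/-! ## §1. One-site fields: «because λ_x(x) = 0»; print's affine gauge function (4.23) on `ℤ^Λ` -/

section OneSite

variable {Λ T : Type*} {V : Type*} [AddCommGroup V] [Module ℝ V]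

/-- **p. 287: «The first function in it is equal to −1/2 i[δB_μ(x), B_μ(x)], because λ_x(x) = 0.»** — as an identity
of fields: for `δ` supported on the bonds at `x` (`hδ`), `λ_x(x) = 0` (`hlam`) and `B(x) = c(x)` (`hB`; `c` stands
for `∂λ_x`, dictionary (iv)), the variation `i[λ_x, δ] − ½ i[δ, ∂λ_x]` of (4.15)₂,₃ EQUALS the field `−½ i[δ, B]`
(both vanish off the bonds at `x`).  Used for `δ = δB` and for the one-site composite fields `i[δB, B]`,
`i[i[δB, B], B]`, `k₂{iad_B, iad_{δB}}∂λ_x` of (4.25)–(4.28). [cite: Balaban1987RG1, p.287] -/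
theorem kappa_oneSite (br : V →ₗ[ℝ] V →ₗ[ℝ] V) (x : T) (lam : T → V) (hlam : lam x = 0)
    (δ c B : Λ → T → V) (hδ : ∀ ν y, y ≠ x → δ ν y = 0) (hB : ∀ ν, B ν x = c ν x) :
    (fun ν y => br (lam y) (δ ν y) - (2 : ℝ)⁻¹ • br (δ ν y) (c ν y)) =
      -((2 : ℝ)⁻¹ • fun ν y => br (δ ν y) (B ν y)) := by
  funext ν y
  simp only [Pi.neg_apply, Pi.smul_apply]
  by_cases hy : y = x
  · subst hy
    simp [hlam, hB]
  · simp [hδ ν y hy]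

/-- A bracket with a one-site field is one-site (so `kappa_oneSite` applies to `i[δB, B]`, `i[i[δB, B], B]`, …).
[folklore] -/
theorem oneSite_br (br : V →ₗ[ℝ] V →ₗ[ℝ] V) (x : T) (δ B : Λ → T → V) (hδ : ∀ ν y, y ≠ x → δ ν y = 0) :
    ∀ ν y, y ≠ x → br (δ ν y) (B ν y) = 0 := fun ν y hy => by simp [hδ ν y hy]

/-- **(4.23), p. 286: «The last factor B_{μ₃}(x) is constant as a function of x₃, and we have B_{μ₃}(x) =
(∂_{μ₃}λ_x)(x₃), λ_x(x₃) = Σ_{ν=1}^{4} (x_{3,ν} − x_ν)B_ν(x).»** — realised on the lattice `ℤ^Λ` (print: the unit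
lattice `T₁^{(j)} ⊂ ℤ⁴`, `Λ` = the four directions, `e_ν = Pi.single ν 1`): the affine function
`λ_x(y) = Σ_μ (y_μ − x_μ) b_μ` (`b = B(x)`, given through `hl`) satisfies `λ_x(x) = 0` and has the CONSTANT lattice
gradient `λ_x(y + e_ν) − λ_x(y) = b_ν`.  (On the finite torus of §4 no such function exists unless `b = 0` — see the
MODEL NOTE of the header; the abstract §§2–3 apply on `ℤ^Λ` verbatim.) [cite: Balaban1987RG1, (4.23) p.286] -/
theorem eq423_affine [Fintype Λ] [DecidableEq Λ] (x : Λ → ℤ) (b : Λ → V) (l : (Λ → ℤ) → V)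
    (hl : ∀ y, l y = ∑ μ, ((y μ - x μ : ℤ) : ℝ) • b μ) :
    l x = 0 ∧ ∀ (ν : Λ) (y : Λ → ℤ), l (y + Pi.single ν 1) - l y = b ν := by
  refine ⟨by simp [hl], fun ν y => ?_⟩
  rw [hl, hl, ← Finset.sum_sub_distrib]
  have h : ∀ μ, ((((y + Pi.single ν 1 : Λ → ℤ) μ - x μ : ℤ) : ℝ) • b μ - ((y μ - x μ : ℤ) : ℝ) • b μ)
      = (if μ = ν then (1 : ℝ) else 0) • b μ := by
    intro μ
    rw [← sub_smul]
    congr 1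
    simp only [Pi.add_apply, Pi.single_apply, Int.cast_sub, Int.cast_add, Int.cast_ite, Int.cast_one,
      Int.cast_zero]
    ring
  simp_rw [h]
  simp

end OneSite

/-! ## §2. (4.21)–(4.29) as exact identities for abstract towers `E2, E3, E4`

Throughout: `E2, E3, E4` continuous multilinear towers on the `𝔤`-valued fields `Λ → T → V` (print's `𝐄^{(2)},
𝐄^{(3)}, 𝐄^{(4)}`), `hs2`, `hs3l`, `hs3r` their slot symmetries; `br` the bracket (`hself : br a a = 0`); `x` the
distinguished point, `lam = λ_x` with `hlam : λ_x(x) = 0`; `δ = δB` one-site at `x` (`hδ`); `B` the field, `c` the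
field standing for `B(x) = ∂λ_x` (`hB : B_ν(x) = c_ν(x)`); `h1`, `h2`, `h3` the identities (4.15)₁,₂,₃ at `B = 0`
with `∂λ ↦ c`, in the shapes of gens 21, 22, 24.  `T` is an arbitrary type here. -/

section Abstract

variable {Λ T : Type*} {V : Type*} [NormedAddCommGroup V] [NormedSpace ℝ V] {F : Type*} [NormedAddCommGroup F]
  [NormedSpace ℝ F]

-- (the quadruply nested operator space over the iterated `Pi` type: one more level of pending instance synthesis)
set_option maxSynthPendingDepth 3 in
/-- **(4.21), p. 285** — the split of the last factor `B_{μ₃}(x₃) = B_{μ₃}(x) + (∂B_{μ₃})(Γ_{x,x₃})`: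
`⟨E4, δB, B, B, B⟩ = ⟨E4, δB, B, B, c⟩ + ⟨E4, δB, B, B, B − c⟩` (linearity in the fourth slot; print's second sum is
the one bounded by (4.22)). [cite: Balaban1987RG1, (4.21) p.285, (4.22) p.286] -/
theorem eq421 (E4 : (Λ → T → V) →L[ℝ] (Λ → T → V) →L[ℝ] (Λ → T → V) →L[ℝ] (Λ → T → V) →L[ℝ] F)
    (δ c B : Λ → T → V) : E4 δ B B B = E4 δ B B c + E4 δ B B (B - c) := by
  rw [← map_add]; congr 1; abel

-- (the quadruply nested operator space over the iterated `Pi` type: one more level of pending instance synthesis)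
set_option maxSynthPendingDepth 3 in
/-- **(4.24), p. 287: «⟨𝐄^{(4)}, δB, B, B, ∂λ_x⟩ = 2⟨𝐄^{(3)}, δB, B, i[λ_x, B] − ½i[B, ∂λ_x]⟩ + ⟨𝐄^{(3)}, i[λ_x, δB] −
½i[δB, ∂λ_x], B, B⟩ − 2⟨𝐄^{(2)}, δB, k₂(iad_B)²∂λ_x⟩ − 2⟨𝐄^{(2)}, k₂{iad_B, iad_{δB}}∂λ_x, B⟩.»** — abstractly, from
`h3` = (4.15)₃ (with `∂λ ↦ c`) at `B₁ = δB`, `B₂ = B₃ = B` and the slot symmetries, with print's coefficients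
`2, 1, −2, −2`, slot orders, `{iad_B, iad_B} = 2(iad_B)²`; the first function of the second term is kept in print's
un-simplified form (it is simplified in `eq429` by `kappa_oneSite`).  The chart case is gen 24's
`fourth_chart_apply_diag_eq`; this is the tower-abstract form used below. [cite: Balaban1987RG1, (4.24) p.287] -/
theorem eq424 (E2 : (Λ → T → V) →L[ℝ] (Λ → T → V) →L[ℝ] F)
    (E3 : (Λ → T → V) →L[ℝ] (Λ → T → V) →L[ℝ] (Λ → T → V) →L[ℝ] F)
    (E4 : (Λ → T → V) →L[ℝ] (Λ → T → V) →L[ℝ] (Λ → T → V) →L[ℝ] (Λ → T → V) →L[ℝ] F)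
    (hs2 : ∀ u v, E2 u v = E2 v u) (hs3l : ∀ u v w, E3 u v w = E3 v u w) (hs3r : ∀ u v w, E3 u v w = E3 u w v)
    (br : V →ₗ[ℝ] V →ₗ[ℝ] V) (lam : T → V) (δ c B : Λ → T → V)
    (h3 : ∀ u₁ u₂ u₃, E4 u₁ u₂ u₃ c
      - E3 u₁ u₂ (fun ν y => br (lam y) (u₃ ν y) - (2 : ℝ)⁻¹ • br (u₃ ν y) (c ν y))
      - E3 u₁ u₃ (fun ν y => br (lam y) (u₂ ν y) - (2 : ℝ)⁻¹ • br (u₂ ν y) (c ν y))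
      - E3 u₂ u₃ (fun ν y => br (lam y) (u₁ ν y) - (2 : ℝ)⁻¹ • br (u₁ ν y) (c ν y))
      + E2 u₁ (fun ν y => (12 : ℝ)⁻¹ • (br (u₂ ν y) (br (u₃ ν y) (c ν y)) + br (u₃ ν y) (br (u₂ ν y) (c ν y))))
      + E2 u₂ (fun ν y => (12 : ℝ)⁻¹ • (br (u₁ ν y) (br (u₃ ν y) (c ν y)) + br (u₃ ν y) (br (u₁ ν y) (c ν y))))
      + E2 u₃ (fun ν y => (12 : ℝ)⁻¹ • (br (u₁ ν y) (br (u₂ ν y) (c ν y)) + br (u₂ ν y) (br (u₁ ν y) (c ν y))))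
      = 0) :
    E4 δ B B c =
      (2 : ℝ) • E3 δ B (fun ν y => br (lam y) (B ν y) - (2 : ℝ)⁻¹ • br (B ν y) (c ν y))
      + E3 (fun ν y => br (lam y) (δ ν y) - (2 : ℝ)⁻¹ • br (δ ν y) (c ν y)) B B
      - (2 : ℝ) • E2 δ (fun ν y => (12 : ℝ)⁻¹ • br (B ν y) (br (B ν y) (c ν y)))
      - (2 : ℝ) • E2 (fun ν y => (12 : ℝ)⁻¹ • (br (B ν y) (br (δ ν y) (c ν y)) + br (δ ν y) (br (B ν y) (c ν y))))
          B := by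
  have H := h3 δ B B
  have e1 : E3 B B (fun ν y => br (lam y) (δ ν y) - (2 : ℝ)⁻¹ • br (δ ν y) (c ν y))
      = E3 (fun ν y => br (lam y) (δ ν y) - (2 : ℝ)⁻¹ • br (δ ν y) (c ν y)) B B := by
    rw [hs3r B B, hs3l B _ B]
  have e2 : E2 δ (fun ν y => (12 : ℝ)⁻¹ • (br (B ν y) (br (B ν y) (c ν y)) + br (B ν y) (br (B ν y) (c ν y))))
      = (2 : ℝ) • E2 δ (fun ν y => (12 : ℝ)⁻¹ • br (B ν y) (br (B ν y) (c ν y))) := by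
    rw [← map_smul]; congr 1; funext ν y; simp only [Pi.smul_apply]; module
  have e3 : E2 B (fun ν y => (12 : ℝ)⁻¹ • (br (δ ν y) (br (B ν y) (c ν y)) + br (B ν y) (br (δ ν y) (c ν y))))
      = E2 (fun ν y => (12 : ℝ)⁻¹ • (br (B ν y) (br (δ ν y) (c ν y)) + br (δ ν y) (br (B ν y) (c ν y)))) B := by
    rw [hs2 B]; congr 2; funext ν y; rw [add_comm]
  rw [e1, e2, e3] at H
  linear_combination (norm := module) H

/-- **(4.25) and the sentence after it, p. 287: «For the last term we have as in (4.21), ⟨𝐄^{(2)}, {iad_B,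
iad_{δB}}∂λ_x, B⟩ = Σ ⟨𝐄^{(2)}_{μ,μ₁}(x, x₁), {iad_{B_μ(x)}, iad_{δB_μ(x)}}B_μ(x), B_{μ₁}(x)⟩ + Σ ⟨𝐄^{(2)}_{μ,μ₁}(x, x₁),
{iad_{B_μ(x)}, iad_{δB_μ(x)}}B_μ(x), (∂B_{μ₁})(Γ_{x,x₁})⟩. (4.25) In the first sum above we write again B_{μ₁}(x) =
(∂_{μ₁}λ_x)(x₁), and by the first identity in (4.15) this sum equals 0.»** — abstractly: the last slot `B = c +
(B − c)` and `h1` = (4.15)₁ kill the `c`-part: `⟨E2, q'', B⟩ = ⟨E2, q'', B − c⟩` EXACTLY, `q''` = print's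
`k₂{iad_B, iad_{δB}}∂λ_x` with `∂λ_x ↦ c` (the remaining term is print's irrelevant second sum).
[cite: Balaban1987RG1, (4.25) p.287] -/
theorem eq425 (E2 : (Λ → T → V) →L[ℝ] (Λ → T → V) →L[ℝ] F)
    (br : V →ₗ[ℝ] V →ₗ[ℝ] V) (δ c B : Λ → T → V) (h1 : ∀ u, E2 u c = 0) :
    E2 (fun ν y => (12 : ℝ)⁻¹ • (br (B ν y) (br (δ ν y) (c ν y)) + br (δ ν y) (br (B ν y) (c ν y)))) B
      = E2 (fun ν y => (12 : ℝ)⁻¹ • (br (B ν y) (br (δ ν y) (c ν y)) + br (δ ν y) (br (B ν y) (c ν y))))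
          (B - c) := by
  rw [map_sub, h1, sub_zero]

/-- **p. 287: «The second function in the term before the last is equal to k₂(iad_{B_{μ₁}(x₁)})²B_{μ₁}(x) =
k₂ iad_{B_{μ₁}(x₁)} i[B_{μ₁}(x₁), B_{μ₁}(x)] = k₂ iad_{B_{μ₁}(x₁)} i[(∂B_{μ₁})(Γ_{x,x₁}), B_{μ₁}(x)], hence this term is
irrelevant also.»** — abstractly, inside `⟨E2, δB, ·⟩`: `k₂ br(B, br(B, c)) = k₂ br(B, br(B − c, c))` since
`br(c, c) = 0` (the whole term is one of print's irrelevant terms; here it is only REWRITTEN to exhibit the factor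
`B − c`). [cite: Balaban1987RG1, p.287] -/
theorem eq_beforeLast (E2 : (Λ → T → V) →L[ℝ] (Λ → T → V) →L[ℝ] F)
    (br : V →ₗ[ℝ] V →ₗ[ℝ] V) (hself : ∀ a, br a a = 0) (δ c B : Λ → T → V) :
    E2 δ (fun ν y => (12 : ℝ)⁻¹ • br (B ν y) (br (B ν y) (c ν y)))
      = E2 δ (fun ν y => (12 : ℝ)⁻¹ • br (B ν y) (br (B ν y - c ν y) (c ν y))) := by
  congr 2; funext ν y; simp [map_sub, LinearMap.sub_apply, hself]

/-- **(4.26)–(4.27), p. 287: «We apply again the same procedure as in (4.21), or (4.25), and it yields −½⟨𝐄^{(3)},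
i[δB, B], B, B⟩ = −½⟨𝐄^{(3)}, i[δB, B], B, ∂λ_x⟩ + (the irrelevant term) = −½⟨𝐄^{(2)}, i[δB, B], i[λ_x, B] − ½i[B,
∂λ_x]⟩ − ½⟨𝐄^{(2)}, i[λ_x, i[δB, B]] − ½i[i[δB, B], ∂λ_x], B⟩ + (the irrelevant term) = −½⟨𝐄^{(2)}, i[δB, B], i[λ_x,
B]⟩ + ¼⟨𝐄^{(2)}, i[i[δB, B], B], B⟩ + (the irrelevant terms), (4.26) where we have used again the equalities
i[B_{μ₁}(x₁), (∂λ_x)_{μ₁}(x₁)] = i[B_{μ₁}(x₁), B_{μ₁}(x)] = i[(∂B_{μ₁})(Γ_{x,x₁}), B_{μ₁}(x)], λ_x(x) = 0. The second term on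
the right-hand side of the last equality in (4.26) is treated as in (4.25), hence it is irrelevant and we obtain
−½⟨𝐄^{(3)}, i[δB, B], B, B⟩ = −½⟨𝐄^{(2)}, i[δB, B], i[λ_x, B]⟩ + (the irrelevant terms). (4.27)»** — EXACT, for the
one-site field `g = i[δB, B]`: `−½⟨E3, g, B, B⟩ = −½⟨E2, g, i[λ_x, B]⟩ + (R₄ + R₅ + R₆)`, `R₄ = −½⟨E3, g, B, B − c⟩`
(«the irrelevant term» of the first equality), `R₅ = ¼⟨E2, g, i[B − c, c]⟩` («the equality written after (4.26)»),
`R₆ = ¼⟨E2, i[g, B], B − c⟩` («treated as in (4.25)», by `h1`).  Uses `h2` = (4.15)₂ at `(g, B)`, `kappa_oneSite`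
for `g` («λ_x(x) = 0»), `h1`, `hs2`. [cite: Balaban1987RG1, (4.26)-(4.27) p.287] -/
theorem eq427 (E2 : (Λ → T → V) →L[ℝ] (Λ → T → V) →L[ℝ] F)
    (E3 : (Λ → T → V) →L[ℝ] (Λ → T → V) →L[ℝ] (Λ → T → V) →L[ℝ] F)
    (hs2 : ∀ u v, E2 u v = E2 v u)
    (br : V →ₗ[ℝ] V →ₗ[ℝ] V) (hself : ∀ a, br a a = 0) (x : T) (lam : T → V) (hlam : lam x = 0)
    (δ c B : Λ → T → V) (hδ : ∀ ν y, y ≠ x → δ ν y = 0) (hB : ∀ ν, B ν x = c ν x)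
    (h1 : ∀ u, E2 u c = 0)
    (h2 : ∀ u v, E3 u v c - E2 u (fun ν y => br (lam y) (v ν y) - (2 : ℝ)⁻¹ • br (v ν y) (c ν y))
      - E2 v (fun ν y => br (lam y) (u ν y) - (2 : ℝ)⁻¹ • br (u ν y) (c ν y)) = 0) :
    -((2 : ℝ)⁻¹ • E3 (fun ν y => br (δ ν y) (B ν y)) B B) =
      -((2 : ℝ)⁻¹ • E2 (fun ν y => br (δ ν y) (B ν y)) (fun ν y => br (lam y) (B ν y)))
      + (-((2 : ℝ)⁻¹ • E3 (fun ν y => br (δ ν y) (B ν y)) B (B - c))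
        + (4 : ℝ)⁻¹ • E2 (fun ν y => br (δ ν y) (B ν y)) (fun ν y => br (B ν y - c ν y) (c ν y))
        + (4 : ℝ)⁻¹ • E2 (fun ν y => br (br (δ ν y) (B ν y)) (B ν y)) (B - c)) := by
  -- the field `g = i[δB, B]` is one-site, so «λ_x(x) = 0» applies to it
  have hg : ∀ ν y, y ≠ x → br (δ ν y) (B ν y) = 0 := oneSite_br br x δ B hδ
  have hκg := kappa_oneSite br x lam hlam (fun ν y => br (δ ν y) (B ν y)) c B hg hB
  -- (4.15)₂ at `(g, B)`
  have W := h2 (fun ν y => br (δ ν y) (B ν y)) B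
  rw [hκg, map_neg, map_smul, hs2 B (fun ν y => br (br (δ ν y) (B ν y)) (B ν y))] at W
  -- slot splits `B = c + (B − c)`
  have S1 : E3 (fun ν y => br (δ ν y) (B ν y)) B B
      = E3 (fun ν y => br (δ ν y) (B ν y)) B c + E3 (fun ν y => br (δ ν y) (B ν y)) B (B - c) := by
    rw [← map_add]; congr 1; abel
  have S2 : E2 (fun ν y => br (br (δ ν y) (B ν y)) (B ν y)) B
      = E2 (fun ν y => br (br (δ ν y) (B ν y)) (B ν y)) c
        + E2 (fun ν y => br (br (δ ν y) (B ν y)) (B ν y)) (B - c) := by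
    rw [← map_add]; congr 1; abel
  -- (4.15)₁
  have Z := h1 (fun ν y => br (br (δ ν y) (B ν y)) (B ν y))
  -- «i[B, ∂λ_x] = i[B − B(x), B(x)]» inside the second slot
  have P : E2 (fun ν y => br (δ ν y) (B ν y)) (fun ν y => br (lam y) (B ν y) - (2 : ℝ)⁻¹ • br (B ν y) (c ν y))
      = E2 (fun ν y => br (δ ν y) (B ν y)) (fun ν y => br (lam y) (B ν y))
        - (2 : ℝ)⁻¹ • E2 (fun ν y => br (δ ν y) (B ν y)) (fun ν y => br (B ν y - c ν y) (c ν y)) := by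
    rw [← map_smul, ← map_sub]; congr 1; funext ν y
    simp only [Pi.sub_apply, Pi.smul_apply, map_sub, LinearMap.sub_apply, hself, sub_zero]
  linear_combination (norm := module) -(2 : ℝ)⁻¹ • S1 - (2 : ℝ)⁻¹ • W - (2 : ℝ)⁻¹ • P
    + (4 : ℝ)⁻¹ • S2 + (4 : ℝ)⁻¹ • Z

/-- **(4.28), pp. 287–288: «Finally consider the first term on the right-hand side of (4.24). This term with the
function −1/2i[B, ∂λ_x] is irrelevant, by the equality written after (4.26). We apply the procedure in (4.21) to the
term with i[λ_x, B] 2⟨𝐄^{(3)}, δB, i[λ_x, B], B⟩ = 2⟨𝐄^{(3)}, δB, i[λ_x, B], ∂λ_x⟩ + (the irrelevant term) =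
2⟨𝐄^{(2)}, δB, i[λ_x, i[λ_x, B]] − ½i[i[λ_x, B], ∂λ_x]⟩ + 2⟨𝐄^{(2)}, i[λ_x, δB] − ½i[δB, ∂λ_x], i[λ_x, B]⟩ + (the
irrelevant term) = 2⟨𝐄^{(2)}, δB, i[λ_x, i[λ_x, B]]⟩ − ⟨𝐄^{(2)}, δB, i[i[λ_x, B], ∂λ_x]⟩ − ⟨𝐄^{(2)}, i[δB, B], i[λ_x,
B]⟩ + (the irrelevant term). (4.28)»** — EXACT, starting from the first term of (4.24) as it stands:
`2⟨E3, δB, B, i[λ_x, B] − ½i[B, c]⟩ = 2⟨E2, δB, i[λ_x, i[λ_x, B]]⟩ − ⟨E2, δB, i[i[λ_x, B], c]⟩ − ⟨E2, i[δB, B],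
i[λ_x, B]⟩ + (R₇ + R₈)`, `R₇ = −⟨E3, δB, B, i[B − c, c]⟩` («This term with the function −1/2 i[B, ∂λ_x] is
irrelevant»), `R₈ = 2⟨E3, δB, i[λ_x, B], B − c⟩` («the irrelevant term» of the first equality).  Uses `h2` = (4.15)₂
at `(δB, i[λ_x, B])`, `kappa_oneSite` («i[λ_x, δB] − ½i[δB, ∂λ_x] = −½ i[δB, B]»), `hs2`, `hs3r`.
[cite: Balaban1987RG1, p.287, (4.28) p.288] -/
theorem eq428 (E2 : (Λ → T → V) →L[ℝ] (Λ → T → V) →L[ℝ] F)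
    (E3 : (Λ → T → V) →L[ℝ] (Λ → T → V) →L[ℝ] (Λ → T → V) →L[ℝ] F)
    (hs2 : ∀ u v, E2 u v = E2 v u) (hs3r : ∀ u v w, E3 u v w = E3 u w v)
    (br : V →ₗ[ℝ] V →ₗ[ℝ] V) (hself : ∀ a, br a a = 0) (x : T) (lam : T → V) (hlam : lam x = 0)
    (δ c B : Λ → T → V) (hδ : ∀ ν y, y ≠ x → δ ν y = 0) (hB : ∀ ν, B ν x = c ν x)
    (h2 : ∀ u v, E3 u v c - E2 u (fun ν y => br (lam y) (v ν y) - (2 : ℝ)⁻¹ • br (v ν y) (c ν y))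
      - E2 v (fun ν y => br (lam y) (u ν y) - (2 : ℝ)⁻¹ • br (u ν y) (c ν y)) = 0) :
    (2 : ℝ) • E3 δ B (fun ν y => br (lam y) (B ν y) - (2 : ℝ)⁻¹ • br (B ν y) (c ν y)) =
      (2 : ℝ) • E2 δ (fun ν y => br (lam y) (br (lam y) (B ν y)))
      - E2 δ (fun ν y => br (br (lam y) (B ν y)) (c ν y))
      - E2 (fun ν y => br (δ ν y) (B ν y)) (fun ν y => br (lam y) (B ν y))
      + (-(E3 δ B (fun ν y => br (B ν y - c ν y) (c ν y)))
        + (2 : ℝ) • E3 δ (fun ν y => br (lam y) (B ν y)) (B - c)) := by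
  have hκδ := kappa_oneSite br x lam hlam δ c B hδ hB
  -- (4.15)₂ at `(δB, i[λ_x, B])`
  have W := h2 δ (fun ν y => br (lam y) (B ν y))
  rw [hκδ, map_neg, map_smul, hs2 (fun ν y => br (lam y) (B ν y)) (fun ν y => br (δ ν y) (B ν y))] at W
  -- «i[B, ∂λ_x] = i[B − B(x), B(x)]» in the third slot, and the slot swap
  have P0 : E3 δ B (fun ν y => br (lam y) (B ν y) - (2 : ℝ)⁻¹ • br (B ν y) (c ν y))
      = E3 δ (fun ν y => br (lam y) (B ν y)) B
        - (2 : ℝ)⁻¹ • E3 δ B (fun ν y => br (B ν y - c ν y) (c ν y)) := by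
    rw [hs3r δ _ B, ← map_smul, ← map_sub]; congr 1; funext ν y
    simp only [Pi.sub_apply, Pi.smul_apply, map_sub, LinearMap.sub_apply, hself, sub_zero]
  -- slot split `B = c + (B − c)`
  have S1 : E3 δ (fun ν y => br (lam y) (B ν y)) B
      = E3 δ (fun ν y => br (lam y) (B ν y)) c + E3 δ (fun ν y => br (lam y) (B ν y)) (B - c) := by
    rw [← map_add]; congr 1; abel
  have P1 : E2 δ (fun ν y => br (lam y) (br (lam y) (B ν y)) - (2 : ℝ)⁻¹ • br (br (lam y) (B ν y)) (c ν y))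
      = E2 δ (fun ν y => br (lam y) (br (lam y) (B ν y)))
        - (2 : ℝ)⁻¹ • E2 δ (fun ν y => br (br (lam y) (B ν y)) (c ν y)) := by
    rw [← map_smul, ← map_sub]; rfl
  linear_combination (norm := module) (2 : ℝ) • P0 + (2 : ℝ) • S1 + (2 : ℝ) • W + (2 : ℝ) • P1

-- (the quadruply nested operator space over the iterated `Pi` type: one more level of pending instance synthesis)
set_option maxSynthPendingDepth 3 in
/-- **(4.29), p. 288: «We can still simplify expressions in the last equalities in (4.27), (4.28), replacing all
fields B by their values at the point x. The difference B(·) − B(x) = (∂B)(Γ_{x,·}) gives rise to irrelevant terms.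
Thus the equalities (4.21), (4.24), and the simplified equalities (4.27), (4.28) yield ⟨𝐄^{(4)}, δB, ⊗³B⟩ =
2⟨𝐄^{(2)}, δB, i[λ_x, i[λ_x, B(x)]]⟩ − ⟨𝐄^{(2)}, δB, i[i[λ_x, B(x)], ∂λ_x]⟩ − 3/2⟨𝐄^{(2)}, i[δB, B], i[λ_x, B(x)]⟩ + (the
irrelevant terms). (4.29)»** — EXACT, pointwise in `x`, with print's coefficients `2, −1, −3/2` (`B(x)`, `∂λ_x ↦ c`)
and the ELEVEN «irrelevant terms» explicit, in this order: `R₁ = ⟨E4, δB, B, B, B − c⟩` [(4.21), bounded in print by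
(4.22)]; `R₂ = −2⟨E2, k₂{iad_B, iad_{δB}}c, B − c⟩` [(4.25), second sum]; `R₃ = −2⟨E2, δB, k₂ iad_B i[B − c, c]⟩`
[«the term before the last»]; `R₄ = −½⟨E3, i[δB,B], B, B − c⟩`, `R₅ = ¼⟨E2, i[δB,B], i[B − c, c]⟩`, `R₆ = ¼⟨E2,
i[i[δB,B],B], B − c⟩` [(4.26)–(4.27)]; `R₇ = −⟨E3, δB, B, i[B − c, c]⟩`, `R₈ = 2⟨E3, δB, i[λ_x,B], B − c⟩` [(4.28)];
`R₉ = 2⟨E2, δB, i[λ_x, i[λ_x, B − c]]⟩`, `R₁₀ = −⟨E2, δB, i[i[λ_x, B − c], c]⟩`, `R₁₁ = −(3/2)⟨E2, i[δB,B], i[λ_x,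
B − c]⟩` [«replacing all fields B by their values at the point x»].  Assembled from `eq421`, `eq424`, `kappa_oneSite`,
`eq425`, `eq_beforeLast`, `eq427`, `eq428` by ONE linear combination.  Hypotheses: all of `hs2`, `hs3l`, `hs3r`,
`hself`, `hlam`, `hδ`, `hB`, `h1`, `h2`, `h3`. [cite: Balaban1987RG1, (4.21) p.285, (4.24)-(4.27) p.287,
(4.28)-(4.29) p.288] -/
theorem eq429 (E2 : (Λ → T → V) →L[ℝ] (Λ → T → V) →L[ℝ] F)
    (E3 : (Λ → T → V) →L[ℝ] (Λ → T → V) →L[ℝ] (Λ → T → V) →L[ℝ] F)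
    (E4 : (Λ → T → V) →L[ℝ] (Λ → T → V) →L[ℝ] (Λ → T → V) →L[ℝ] (Λ → T → V) →L[ℝ] F)
    (hs2 : ∀ u v, E2 u v = E2 v u) (hs3l : ∀ u v w, E3 u v w = E3 v u w) (hs3r : ∀ u v w, E3 u v w = E3 u w v)
    (br : V →ₗ[ℝ] V →ₗ[ℝ] V) (hself : ∀ a, br a a = 0) (x : T) (lam : T → V) (hlam : lam x = 0)
    (δ c B : Λ → T → V) (hδ : ∀ ν y, y ≠ x → δ ν y = 0) (hB : ∀ ν, B ν x = c ν x)
    (h1 : ∀ u, E2 u c = 0)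
    (h2 : ∀ u v, E3 u v c - E2 u (fun ν y => br (lam y) (v ν y) - (2 : ℝ)⁻¹ • br (v ν y) (c ν y))
      - E2 v (fun ν y => br (lam y) (u ν y) - (2 : ℝ)⁻¹ • br (u ν y) (c ν y)) = 0)
    (h3 : ∀ u₁ u₂ u₃, E4 u₁ u₂ u₃ c
      - E3 u₁ u₂ (fun ν y => br (lam y) (u₃ ν y) - (2 : ℝ)⁻¹ • br (u₃ ν y) (c ν y))
      - E3 u₁ u₃ (fun ν y => br (lam y) (u₂ ν y) - (2 : ℝ)⁻¹ • br (u₂ ν y) (c ν y))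
      - E3 u₂ u₃ (fun ν y => br (lam y) (u₁ ν y) - (2 : ℝ)⁻¹ • br (u₁ ν y) (c ν y))
      + E2 u₁ (fun ν y => (12 : ℝ)⁻¹ • (br (u₂ ν y) (br (u₃ ν y) (c ν y)) + br (u₃ ν y) (br (u₂ ν y) (c ν y))))
      + E2 u₂ (fun ν y => (12 : ℝ)⁻¹ • (br (u₁ ν y) (br (u₃ ν y) (c ν y)) + br (u₃ ν y) (br (u₁ ν y) (c ν y))))
      + E2 u₃ (fun ν y => (12 : ℝ)⁻¹ • (br (u₁ ν y) (br (u₂ ν y) (c ν y)) + br (u₂ ν y) (br (u₁ ν y) (c ν y))))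
      = 0) :
    E4 δ B B B =
      (2 : ℝ) • E2 δ (fun ν y => br (lam y) (br (lam y) (c ν y)))
      - E2 δ (fun ν y => br (br (lam y) (c ν y)) (c ν y))
      - (3 / 2 : ℝ) • E2 (fun ν y => br (δ ν y) (B ν y)) (fun ν y => br (lam y) (c ν y))
      + (E4 δ B B (B - c)
        - (2 : ℝ) • E2 (fun ν y => (12 : ℝ)⁻¹ • (br (B ν y) (br (δ ν y) (c ν y))
            + br (δ ν y) (br (B ν y) (c ν y)))) (B - c)
        - (2 : ℝ) • E2 δ (fun ν y => (12 : ℝ)⁻¹ • br (B ν y) (br (B ν y - c ν y) (c ν y)))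
        - (2 : ℝ)⁻¹ • E3 (fun ν y => br (δ ν y) (B ν y)) B (B - c)
        + (4 : ℝ)⁻¹ • E2 (fun ν y => br (δ ν y) (B ν y)) (fun ν y => br (B ν y - c ν y) (c ν y))
        + (4 : ℝ)⁻¹ • E2 (fun ν y => br (br (δ ν y) (B ν y)) (B ν y)) (B - c)
        - E3 δ B (fun ν y => br (B ν y - c ν y) (c ν y))
        + (2 : ℝ) • E3 δ (fun ν y => br (lam y) (B ν y)) (B - c)
        + (2 : ℝ) • E2 δ (fun ν y => br (lam y) (br (lam y) (B ν y - c ν y)))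
        - E2 δ (fun ν y => br (br (lam y) (B ν y - c ν y)) (c ν y))
        - (3 / 2 : ℝ) • E2 (fun ν y => br (δ ν y) (B ν y)) (fun ν y => br (lam y) (B ν y - c ν y))) := by
  have S0 := eq421 E4 δ c B
  have A := eq424 E2 E3 E4 hs2 hs3l hs3r br lam δ c B h3
  -- «The first function in it is equal to −1/2 i[δB_μ(x), B_μ(x)], because λ_x(x) = 0»
  have hκδ := kappa_oneSite br x lam hlam δ c B hδ hB
  have K : E3 (fun ν y => br (lam y) (δ ν y) - (2 : ℝ)⁻¹ • br (δ ν y) (c ν y)) B B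
      = -((2 : ℝ)⁻¹ • E3 (fun ν y => br (δ ν y) (B ν y)) B B) := by
    rw [hκδ, map_neg, map_smul]
    simp only [neg_apply, smul_apply]
  have Q25 := eq425 E2 br δ c B h1
  have QbL := eq_beforeLast E2 br hself δ c B
  have E27 := eq427 E2 E3 hs2 br hself x lam hlam δ c B hδ hB h1 h2
  have E28 := eq428 E2 E3 hs2 hs3r br hself x lam hlam δ c B hδ hB h2
  -- «replacing all fields B by their values at the point x»: `B = c + (B − c)` inside the brackets
  have V1 : E2 (fun ν y => br (δ ν y) (B ν y)) (fun ν y => br (lam y) (B ν y))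
      = E2 (fun ν y => br (δ ν y) (B ν y)) (fun ν y => br (lam y) (c ν y))
        + E2 (fun ν y => br (δ ν y) (B ν y)) (fun ν y => br (lam y) (B ν y - c ν y)) := by
    rw [← map_add]; congr 1; funext ν y; simp only [Pi.add_apply, map_sub]; abel
  have V2 : E2 δ (fun ν y => br (lam y) (br (lam y) (B ν y)))
      = E2 δ (fun ν y => br (lam y) (br (lam y) (c ν y)))
        + E2 δ (fun ν y => br (lam y) (br (lam y) (B ν y - c ν y))) := by
    rw [← map_add]; congr 1; funext ν y; simp only [Pi.add_apply, map_sub]; abel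
  have V3 : E2 δ (fun ν y => br (br (lam y) (B ν y)) (c ν y))
      = E2 δ (fun ν y => br (br (lam y) (c ν y)) (c ν y))
        + E2 δ (fun ν y => br (br (lam y) (B ν y - c ν y)) (c ν y)) := by
    rw [← map_add]; congr 1; funext ν y; simp only [Pi.add_apply, map_sub, LinearMap.sub_apply]; abel
  linear_combination (norm := module) S0 + A + K + E27 + E28 - (2 : ℝ) • Q25 - (2 : ℝ) • QbL
    - (3 / 2 : ℝ) • V1 + (2 : ℝ) • V2 - V3

-- (the quadruply nested operator space over the iterated `Pi` type: one more level of pending instance synthesis)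
set_option maxSynthPendingDepth 3 in
/-- **(4.29) AT `B = B(x)`** — the identity without remainder: for `B = c` (the field coincides with «its value at the
point x», so that every `Rᵢ` of `eq429` vanishes), `⟨E4, δB, c, c, c⟩ = 2⟨E2, δB, i[λ_x, i[λ_x, c]]⟩ − ⟨E2, δB,
i[i[λ_x, c], c]⟩ − (3/2)⟨E2, i[δB, c], i[λ_x, c]⟩`; proved directly from `h1`, `h2`, `h3` (print's (4.29) with all
fields «taken at the point x»). [cite: Balaban1987RG1, (4.29) p.288] -/
theorem eq429_atPoint (E2 : (Λ → T → V) →L[ℝ] (Λ → T → V) →L[ℝ] F)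
    (E3 : (Λ → T → V) →L[ℝ] (Λ → T → V) →L[ℝ] (Λ → T → V) →L[ℝ] F)
    (E4 : (Λ → T → V) →L[ℝ] (Λ → T → V) →L[ℝ] (Λ → T → V) →L[ℝ] (Λ → T → V) →L[ℝ] F)
    (hs2 : ∀ u v, E2 u v = E2 v u) (hs3l : ∀ u v w, E3 u v w = E3 v u w) (hs3r : ∀ u v w, E3 u v w = E3 u w v)
    (br : V →ₗ[ℝ] V →ₗ[ℝ] V) (hself : ∀ a, br a a = 0) (x : T) (lam : T → V) (hlam : lam x = 0)
    (δ c : Λ → T → V) (hδ : ∀ ν y, y ≠ x → δ ν y = 0)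
    (h1 : ∀ u, E2 u c = 0)
    (h2 : ∀ u v, E3 u v c - E2 u (fun ν y => br (lam y) (v ν y) - (2 : ℝ)⁻¹ • br (v ν y) (c ν y))
      - E2 v (fun ν y => br (lam y) (u ν y) - (2 : ℝ)⁻¹ • br (u ν y) (c ν y)) = 0)
    (h3 : ∀ u₁ u₂ u₃, E4 u₁ u₂ u₃ c
      - E3 u₁ u₂ (fun ν y => br (lam y) (u₃ ν y) - (2 : ℝ)⁻¹ • br (u₃ ν y) (c ν y))
      - E3 u₁ u₃ (fun ν y => br (lam y) (u₂ ν y) - (2 : ℝ)⁻¹ • br (u₂ ν y) (c ν y))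
      - E3 u₂ u₃ (fun ν y => br (lam y) (u₁ ν y) - (2 : ℝ)⁻¹ • br (u₁ ν y) (c ν y))
      + E2 u₁ (fun ν y => (12 : ℝ)⁻¹ • (br (u₂ ν y) (br (u₃ ν y) (c ν y)) + br (u₃ ν y) (br (u₂ ν y) (c ν y))))
      + E2 u₂ (fun ν y => (12 : ℝ)⁻¹ • (br (u₁ ν y) (br (u₃ ν y) (c ν y)) + br (u₃ ν y) (br (u₁ ν y) (c ν y))))
      + E2 u₃ (fun ν y => (12 : ℝ)⁻¹ • (br (u₁ ν y) (br (u₂ ν y) (c ν y)) + br (u₂ ν y) (br (u₁ ν y) (c ν y))))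
      = 0) :
    E4 δ c c c =
      (2 : ℝ) • E2 δ (fun ν y => br (lam y) (br (lam y) (c ν y)))
      - E2 δ (fun ν y => br (br (lam y) (c ν y)) (c ν y))
      - (3 / 2 : ℝ) • E2 (fun ν y => br (δ ν y) (c ν y)) (fun ν y => br (lam y) (c ν y)) := by
  have H := h3 δ c c
  have hκδ := kappa_oneSite br x lam hlam δ c c hδ (fun ν => rfl)
  have hg : ∀ ν y, y ≠ x → br (δ ν y) (c ν y) = 0 := oneSite_br br x δ c hδ
  have hκg := kappa_oneSite br x lam hlam (fun ν y => br (δ ν y) (c ν y)) c c hg (fun ν => rfl)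
  have F1 : (fun ν y => br (lam y) (c ν y) - (2 : ℝ)⁻¹ • br (c ν y) (c ν y)) = fun ν y => br (lam y) (c ν y) := by
    funext ν y; simp [hself]
  have F2 : (fun ν y => (12 : ℝ)⁻¹ • (br (c ν y) (br (c ν y) (c ν y)) + br (c ν y) (br (c ν y) (c ν y))))
      = 0 := by
    funext ν y; simp [hself]
  have F3 : (fun ν y => (12 : ℝ)⁻¹ • (br (δ ν y) (br (c ν y) (c ν y)) + br (c ν y) (br (δ ν y) (c ν y))))
      = fun ν y => (12 : ℝ)⁻¹ • br (c ν y) (br (δ ν y) (c ν y)) := by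
    funext ν y; simp [hself]
  rw [F1, hκδ, F2, F3, map_neg, map_smul, map_zero, hs2 c, h1] at H
  -- `E3 c c g = E3 g c c = E2 g i[λ_x, c]` for the one-site `g = i[δB, c]`
  have W1 := h2 (fun ν y => br (δ ν y) (c ν y)) c
  rw [F1, hκg, map_neg, map_smul, hs2 c (fun ν y => br (br (δ ν y) (c ν y)) (c ν y)), h1] at W1
  have e1 : E3 c c (fun ν y => br (δ ν y) (c ν y)) = E3 (fun ν y => br (δ ν y) (c ν y)) c c := by
    rw [hs3r c c, hs3l c _ c]
  -- `E3 δ c i[λ_x, c] = E3 δ i[λ_x, c] c = …` by (4.15)₂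
  have W2 := h2 δ (fun ν y => br (lam y) (c ν y))
  rw [hκδ, map_neg, map_smul, hs2 (fun ν y => br (lam y) (c ν y)) (fun ν y => br (δ ν y) (c ν y))] at W2
  have e2 : E3 δ c (fun ν y => br (lam y) (c ν y)) = E3 δ (fun ν y => br (lam y) (c ν y)) c := hs3r δ c _
  have P : E2 δ (fun ν y => br (lam y) (br (lam y) (c ν y)) - (2 : ℝ)⁻¹ • br (br (lam y) (c ν y)) (c ν y))
      = E2 δ (fun ν y => br (lam y) (br (lam y) (c ν y)))
        - (2 : ℝ)⁻¹ • E2 δ (fun ν y => br (br (lam y) (c ν y)) (c ν y)) := by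
    rw [← map_smul, ← map_sub]; rfl
  linear_combination (norm := module) H + (2 : ℝ) • e2 + (2 : ℝ) • W2 + (2 : ℝ) • P - (2 : ℝ)⁻¹ • e1
    - (2 : ℝ)⁻¹ • W1

end Abstract

/-! ## §3. (4.30)–(4.31) as exact identities for abstract towers `E2, E3`

As in §2, plus `ℓ` = print's `B(·, x)` (the linear Taylor term of (4.30) at `x`; NOTHING about it is used) and
`B − c − ℓ` = the second-order Taylor remainder `B^{(2)}`; only `h1`, `h2` and the symmetry of `E3` in its last two
slots are needed. -/

section AbstractThird

variable {Λ T : Type*} {V : Type*} [NormedAddCommGroup V] [NormedSpace ℝ V] {F : Type*} [NormedAddCommGroup F]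
  [NormedSpace ℝ F]

/-- **(4.30) applied, p. 288: «This formula is applied to the function B_{μ₃}(x₃) at y = x₃.»** — the split of the
last slot `B = B(x) + B(·, x) + B^{(2)}`: `⟨E3, δB, B, B⟩ = ⟨E3, δB, B, c⟩ + ⟨E3, δB, B, ℓ⟩ + ⟨E3, δB, B, B − c − ℓ⟩`
(linearity; the Taylor formula (4.30) itself is not formalised — `ℓ`, `B − c − ℓ` are names).
[cite: Balaban1987RG1, (4.30) p.288] -/
theorem eq430_split (E3 : (Λ → T → V) →L[ℝ] (Λ → T → V) →L[ℝ] (Λ → T → V) →L[ℝ] F) (δ c B ℓ : Λ → T → V) :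
    E3 δ B B = E3 δ B c + E3 δ B ℓ + E3 δ B (B - c - ℓ) := by
  rw [← map_add, ← map_add]; congr 1; abel

/-- **(4.31), p. 289: «We have ⟨𝐄^{(3)}, δB, ⊗²B⟩ = ⟨𝐄^{(3)}, δB, B, ∂λ_x⟩ + ⟨𝐄^{(3)}, δB, B, B(·, x)⟩ + (the irrelevant
term) = ⟨𝐄^{(2)}, δB, i[λ_x, B] − ½i[B, ∂λ_x]⟩ − ½⟨𝐄^{(2)}, i[δB, B], B⟩ + ⟨𝐄^{(3)}, δB, B(·, x), ∂λ_x⟩ + (the irrelevant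
term) = ⟨𝐄^{(2)}, δB, i[λ_x, B]⟩ − ½⟨𝐄^{(2)}, δB, i[B, B(x)]⟩ − ½⟨𝐄^{(2)}, i[δB, B], B(·, x)⟩ + ⟨𝐄², δB, i[λ_x, B(·, x)]
− ½i[B(·, x), ∂λ_x]⟩ − ½⟨𝐄^{(2)}, i[δB, B], B(·, x)⟩ + (the irrelevant terms) = ⟨𝐄^{(2)}, δB, i[λ_x, B(x)]⟩ +
2⟨𝐄^{(2)}, δB, i[λ_x, B(·, x)]⟩ − ⟨𝐄^{(2)}, δB, i[B(·, x), B(x)]⟩ − ⟨𝐄^{(2)}, i[δB, B], B(·, x)⟩ + (the irrelevant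
terms). (4.31) Here, in the last equality, all fields and their derivatives are taken at the point x.»** — EXACT,
pointwise in `x`, with print's final coefficients `1, 2, −1, −1` (`B(x)`, `∂λ_x ↦ c`, `B(·, x) ↦ ℓ`) and the SIX
«irrelevant terms» explicit, in this order: `S₁ = ⟨E3, δB, B, B − c − ℓ⟩` [the `B^{(2)}`-term of line 1, bounded in
print through (4.18)]; `S₂ = ⟨E3, δB, ℓ, ℓ⟩`, `S₃ = ⟨E3, δB, B − c − ℓ, ℓ⟩` [absorbed between lines 1 and 2, where
`⟨E3, δB, B, B(·, x)⟩` becomes `⟨E3, δB, B(·, x), ∂λ_x⟩`; NOTE `S₂` carries two factors `B(·, x)` and no `B^{(2)}`];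
`S₄ = −½⟨E2, i[δB, B], B − c − ℓ⟩`, `S₅ = ⟨E2, δB, i[λ_x, B − c − ℓ]⟩`, `S₆ = −½⟨E2, δB, i[B − c − ℓ, c]⟩` [lines
2 → 4: «all fields … taken at the point x»].  Uses `h2` = (4.15)₂ at `(δB, B)` and `(δB, ℓ)`, `kappa_oneSite`, `h1`
(for `½⟨E2, i[δB, B], c⟩ = 0`), `hs2`, `hs3r`, `hself`. [cite: Balaban1987RG1, (4.30) p.288, (4.31) p.289] -/
theorem eq431 (E2 : (Λ → T → V) →L[ℝ] (Λ → T → V) →L[ℝ] F)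
    (E3 : (Λ → T → V) →L[ℝ] (Λ → T → V) →L[ℝ] (Λ → T → V) →L[ℝ] F)
    (hs2 : ∀ u v, E2 u v = E2 v u) (hs3r : ∀ u v w, E3 u v w = E3 u w v)
    (br : V →ₗ[ℝ] V →ₗ[ℝ] V) (hself : ∀ a, br a a = 0) (x : T) (lam : T → V) (hlam : lam x = 0)
    (δ c B ℓ : Λ → T → V) (hδ : ∀ ν y, y ≠ x → δ ν y = 0) (hB : ∀ ν, B ν x = c ν x)
    (h1 : ∀ u, E2 u c = 0)
    (h2 : ∀ u v, E3 u v c - E2 u (fun ν y => br (lam y) (v ν y) - (2 : ℝ)⁻¹ • br (v ν y) (c ν y))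
      - E2 v (fun ν y => br (lam y) (u ν y) - (2 : ℝ)⁻¹ • br (u ν y) (c ν y)) = 0) :
    E3 δ B B =
      E2 δ (fun ν y => br (lam y) (c ν y))
      + (2 : ℝ) • E2 δ (fun ν y => br (lam y) (ℓ ν y))
      - E2 δ (fun ν y => br (ℓ ν y) (c ν y))
      - E2 (fun ν y => br (δ ν y) (B ν y)) ℓ
      + (E3 δ B (B - c - ℓ)
        + E3 δ ℓ ℓ
        + E3 δ (B - c - ℓ) ℓ
        - (2 : ℝ)⁻¹ • E2 (fun ν y => br (δ ν y) (B ν y)) (B - c - ℓ)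
        + E2 δ (fun ν y => br (lam y) (B ν y - c ν y - ℓ ν y))
        - (2 : ℝ)⁻¹ • E2 δ (fun ν y => br (B ν y - c ν y - ℓ ν y) (c ν y))) := by
  have hκδ := kappa_oneSite br x lam hlam δ c B hδ hB
  -- (4.15)₂ at `(δB, B)` and `(δB, ℓ)`
  have W1 := h2 δ B
  have W2 := h2 δ ℓ
  rw [hκδ, map_neg, map_smul, hs2 B] at W1
  rw [hκδ, map_neg, map_smul, hs2 ℓ] at W2
  -- (4.15)₁
  have Z1 : E2 (fun ν y => br (δ ν y) (B ν y)) c = 0 := h1 _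
  -- slot splits `B = c + ℓ + (B − c − ℓ)`
  have S1 := eq430_split E3 δ c B ℓ
  have S2 : E3 δ B ℓ = E3 δ ℓ c + E3 δ ℓ ℓ + E3 δ (B - c - ℓ) ℓ := by
    rw [hs3r δ B ℓ, hs3r δ (B - c - ℓ) ℓ, ← map_add, ← map_add]; congr 1; abel
  have S3 : E2 (fun ν y => br (δ ν y) (B ν y)) B = E2 (fun ν y => br (δ ν y) (B ν y)) c
      + E2 (fun ν y => br (δ ν y) (B ν y)) ℓ + E2 (fun ν y => br (δ ν y) (B ν y)) (B - c - ℓ) := by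
    rw [← map_add, ← map_add]; congr 1; abel
  -- bracket splits inside the second slot («all fields … taken at the point x»)
  have P1 : E2 δ (fun ν y => br (lam y) (B ν y) - (2 : ℝ)⁻¹ • br (B ν y) (c ν y))
      = E2 δ (fun ν y => br (lam y) (c ν y)) + E2 δ (fun ν y => br (lam y) (ℓ ν y))
        + E2 δ (fun ν y => br (lam y) (B ν y - c ν y - ℓ ν y))
        - (2 : ℝ)⁻¹ • (E2 δ (fun ν y => br (ℓ ν y) (c ν y))
          + E2 δ (fun ν y => br (B ν y - c ν y - ℓ ν y) (c ν y))) := by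
    rw [← map_add, ← map_add, ← map_add, ← map_smul, ← map_sub]
    congr 1
    funext ν y
    simp only [Pi.add_apply, Pi.sub_apply, Pi.smul_apply, map_sub, LinearMap.sub_apply, hself, smul_add,
      smul_sub, smul_zero]
    abel
  have P2 : E2 δ (fun ν y => br (lam y) (ℓ ν y) - (2 : ℝ)⁻¹ • br (ℓ ν y) (c ν y))
      = E2 δ (fun ν y => br (lam y) (ℓ ν y)) - (2 : ℝ)⁻¹ • E2 δ (fun ν y => br (ℓ ν y) (c ν y)) := by
    rw [← map_smul, ← map_sub]
    rfl
  linear_combination (norm := module) S1 + S2 + W1 + W2 + P1 + P2 - (2 : ℝ)⁻¹ • S3 - (2 : ℝ)⁻¹ • Z1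

/-- **(4.31) AT `B = B(x)`, `B(·, x) = 0`** — the identity without remainder: `⟨E3, δB, c, c⟩ = ⟨E2, δB, i[λ_x, c]⟩`
(from `h2` at `(δB, c)`, `[c, c] = 0`, `hs2` and `h1`; no one-site hypothesis is even needed).
[cite: Balaban1987RG1, (4.31) p.289] -/
theorem eq431_atPoint (E2 : (Λ → T → V) →L[ℝ] (Λ → T → V) →L[ℝ] F)
    (E3 : (Λ → T → V) →L[ℝ] (Λ → T → V) →L[ℝ] (Λ → T → V) →L[ℝ] F)
    (hs2 : ∀ u v, E2 u v = E2 v u) (br : V →ₗ[ℝ] V →ₗ[ℝ] V) (hself : ∀ a, br a a = 0) (lam : T → V)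
    (δ c : Λ → T → V) (h1 : ∀ u, E2 u c = 0)
    (h2 : ∀ u v, E3 u v c - E2 u (fun ν y => br (lam y) (v ν y) - (2 : ℝ)⁻¹ • br (v ν y) (c ν y))
      - E2 v (fun ν y => br (lam y) (u ν y) - (2 : ℝ)⁻¹ • br (u ν y) (c ν y)) = 0) :
    E3 δ c c = E2 δ (fun ν y => br (lam y) (c ν y)) := by
  have W := h2 δ c
  have F1 : (fun ν y => br (lam y) (c ν y) - (2 : ℝ)⁻¹ • br (c ν y) (c ν y)) = fun ν y => br (lam y) (c ν y) := by
    funext ν y; simp [hself]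
  rw [F1, hs2 c, h1, sub_zero, sub_eq_zero] at W
  exact W

end AbstractThird

/-! ## §4. In the chart of gens 21–24: the hypotheses of §§2–3 discharged by name from (4.7), smoothness and
«The group G is semisimple» -/

section Chart

variable {𝔄 : Type*} [NormedRing 𝔄] [NormedAlgebra ℝ 𝔄] [CompleteSpace 𝔄] {Λ T : Type*} [Fintype Λ] [Fintype T]
  [AddCommGroup T] {V : Type*} [NormedAddCommGroup V] [NormedSpace ℝ V] {F : Type*} [NormedAddCommGroup F]
  [NormedSpace ℝ F]

/-- The Ward–Takahashi identities (4.15)₁,₂ at `B = 0` in the chart `f(B) = 𝐄(exp ρB)` of gens 21, 22 (`𝐄` `C³`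
at `1`), re-packaged in the shapes `h1`, `h2` of §§2–3: slots `∂λ ↦ c` through `hc : λ(y + e_ν) − λ(y) = c_ν(y)`,
the variations built from a bilinear bracket `br` represented by the commutator (`hbr`), with `𝔤` (read through `ρ`)
spanned by commutators (`hspan`, print's «The group G is semisimple»; closure is automatic from `hbr`).  By name:
`…B12Semisimple414.hessian_chart_apply_grad_eq_zero` ((4.14) ⇒ (4.15)₁),
`…B12WardSecond415.third_chart_apply_grad_eq_zero_of_bracket` ((4.15)₂).
[cite: Balaban1987RG1, (4.7) p.282, (4.14)-(4.15) p.284] -/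
theorem wt12_chart_of_bracket {ℰ : (Λ → T → 𝔄) → F} (e : Λ → T) (ρ : V →L[ℝ] 𝔄) (hℰ : ContDiffAt ℝ 3 ℰ 1)
    (h47 : ∀ lam : T → V, ∀ᶠ W in 𝓝 (1 : Λ → T → 𝔄), ∀ᶠ t in 𝓝 (0 : ℝ),
      ℰ (fun ν x => exp (t • ρ (lam x)) * W ν x * exp (-(t • ρ (lam (x + e ν))))) = ℰ W)
    (br : V →ₗ[ℝ] V →ₗ[ℝ] V) (hbr : ∀ a b, ρ (br a b) = ρ a * ρ b - ρ b * ρ a)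
    (hspan : Submodule.span ℝ {c : V | ∃ l v : V, ρ c = ρ l * ρ v - ρ v * ρ l} = ⊤)
    (lam : T → V) (c : Λ → T → V) (hc : ∀ ν y, lam (y + e ν) - lam y = c ν y) :
    (∀ u, fderiv ℝ (fderiv ℝ (fun A : Λ → T → V => ℰ (fun ν y => exp (ρ (A ν y))))) 0 u c = 0)
    ∧ (∀ u v, fderiv ℝ (fderiv ℝ (fderiv ℝ (fun A : Λ → T → V => ℰ (fun ν y => exp (ρ (A ν y)))))) 0 u v c
      - fderiv ℝ (fderiv ℝ (fun A : Λ → T → V => ℰ (fun ν y => exp (ρ (A ν y))))) 0 u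
          (fun ν y => br (lam y) (v ν y) - (2 : ℝ)⁻¹ • br (v ν y) (c ν y))
      - fderiv ℝ (fderiv ℝ (fun A : Λ → T → V => ℰ (fun ν y => exp (ρ (A ν y))))) 0 v
          (fun ν y => br (lam y) (u ν y) - (2 : ℝ)⁻¹ • br (u ν y) (c ν y)) = 0) := by
  have hcF : (fun ν y => lam (y + e ν) - lam y) = c := funext fun ν => funext fun y => hc ν y
  refine ⟨fun u => ?_, fun u v => ?_⟩
  · have h := hessian_chart_apply_grad_eq_zero e ρ (hℰ.of_le (by norm_num)) h47 (fun a b => ⟨br a b, hbr a b⟩)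
      hspan u lam
    rwa [hcF] at h
  · have h := third_chart_apply_grad_eq_zero_of_bracket e ρ hℰ h47 (fun a b => br a b) hbr hspan u v lam
    rw [hcF] at h
    simpa only [hc] using h

-- (the quadruply nested operator space over the iterated `Pi` type: one more level of pending instance synthesis)
set_option maxSynthPendingDepth 3 in
/-- `wt12_chart_of_bracket` plus **(4.15)₃ at `B = 0` in the chart** in the shape `h3` of §2 (needs `C⁴`), by name
from `…B12WardThird415.fourth_chart_apply_grad_eq_zero_of_bracket`. [cite: Balaban1987RG1, (4.7) p.282,
    (4.15) p.284] -/
theorem wt_chart_of_bracket {ℰ : (Λ → T → 𝔄) → F} (e : Λ → T) (ρ : V →L[ℝ] 𝔄) (hℰ : ContDiffAt ℝ 4 ℰ 1)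
    (h47 : ∀ lam : T → V, ∀ᶠ W in 𝓝 (1 : Λ → T → 𝔄), ∀ᶠ t in 𝓝 (0 : ℝ),
      ℰ (fun ν x => exp (t • ρ (lam x)) * W ν x * exp (-(t • ρ (lam (x + e ν))))) = ℰ W)
    (br : V →ₗ[ℝ] V →ₗ[ℝ] V) (hbr : ∀ a b, ρ (br a b) = ρ a * ρ b - ρ b * ρ a)
    (hspan : Submodule.span ℝ {c : V | ∃ l v : V, ρ c = ρ l * ρ v - ρ v * ρ l} = ⊤)
    (lam : T → V) (c : Λ → T → V) (hc : ∀ ν y, lam (y + e ν) - lam y = c ν y) :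
    (∀ u, fderiv ℝ (fderiv ℝ (fun A : Λ → T → V => ℰ (fun ν y => exp (ρ (A ν y))))) 0 u c = 0)
    ∧ (∀ u v, fderiv ℝ (fderiv ℝ (fderiv ℝ (fun A : Λ → T → V => ℰ (fun ν y => exp (ρ (A ν y)))))) 0 u v c
      - fderiv ℝ (fderiv ℝ (fun A : Λ → T → V => ℰ (fun ν y => exp (ρ (A ν y))))) 0 u
          (fun ν y => br (lam y) (v ν y) - (2 : ℝ)⁻¹ • br (v ν y) (c ν y))
      - fderiv ℝ (fderiv ℝ (fun A : Λ → T → V => ℰ (fun ν y => exp (ρ (A ν y))))) 0 v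
          (fun ν y => br (lam y) (u ν y) - (2 : ℝ)⁻¹ • br (u ν y) (c ν y)) = 0)
    ∧ (∀ u₁ u₂ u₃,
      fderiv ℝ (fderiv ℝ (fderiv ℝ (fderiv ℝ (fun A : Λ → T → V => ℰ (fun ν y => exp (ρ (A ν y))))))) 0 u₁ u₂ u₃ c
      - fderiv ℝ (fderiv ℝ (fderiv ℝ (fun A : Λ → T → V => ℰ (fun ν y => exp (ρ (A ν y)))))) 0 u₁ u₂
          (fun ν y => br (lam y) (u₃ ν y) - (2 : ℝ)⁻¹ • br (u₃ ν y) (c ν y))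
      - fderiv ℝ (fderiv ℝ (fderiv ℝ (fun A : Λ → T → V => ℰ (fun ν y => exp (ρ (A ν y)))))) 0 u₁ u₃
          (fun ν y => br (lam y) (u₂ ν y) - (2 : ℝ)⁻¹ • br (u₂ ν y) (c ν y))
      - fderiv ℝ (fderiv ℝ (fderiv ℝ (fun A : Λ → T → V => ℰ (fun ν y => exp (ρ (A ν y)))))) 0 u₂ u₃
          (fun ν y => br (lam y) (u₁ ν y) - (2 : ℝ)⁻¹ • br (u₁ ν y) (c ν y))
      + fderiv ℝ (fderiv ℝ (fun A : Λ → T → V => ℰ (fun ν y => exp (ρ (A ν y))))) 0 u₁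
          (fun ν y => (12 : ℝ)⁻¹ • (br (u₂ ν y) (br (u₃ ν y) (c ν y)) + br (u₃ ν y) (br (u₂ ν y) (c ν y))))
      + fderiv ℝ (fderiv ℝ (fun A : Λ → T → V => ℰ (fun ν y => exp (ρ (A ν y))))) 0 u₂
          (fun ν y => (12 : ℝ)⁻¹ • (br (u₁ ν y) (br (u₃ ν y) (c ν y)) + br (u₃ ν y) (br (u₁ ν y) (c ν y))))
      + fderiv ℝ (fderiv ℝ (fun A : Λ → T → V => ℰ (fun ν y => exp (ρ (A ν y))))) 0 u₃
          (fun ν y => (12 : ℝ)⁻¹ • (br (u₁ ν y) (br (u₂ ν y) (c ν y)) + br (u₂ ν y) (br (u₁ ν y) (c ν y))))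
      = 0) := by
  have hcF : (fun ν y => lam (y + e ν) - lam y) = c := funext fun ν => funext fun y => hc ν y
  have h12 := wt12_chart_of_bracket e ρ (hℰ.of_le (by norm_num)) h47 br hbr hspan lam c hc
  refine ⟨h12.1, h12.2, fun u₁ u₂ u₃ => ?_⟩
  have h := fourth_chart_apply_grad_eq_zero_of_bracket e ρ hℰ lam (h47 lam) (fun a b => br a b) hbr u₁ u₂ u₃
  rw [hcF] at h
  simpa only [hc] using h


-- (the quadruply nested operator space over the iterated `Pi` type: one more level of pending instance synthesis)
set_option maxSynthPendingDepth 3 in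
/-- **(4.29) in the chart, from (4.7), `C⁴`-smoothness and perfectness** — `eq429` for `E2, E3, E4` the second,
third, fourth derivatives at `B = 0` of `f(B) = 𝐄(exp ρB)` (print's `𝐄^{(k)} = (δᵏ/δBᵏ)𝐄(1)`), the bracket any
alternating bilinear `br` represented by the commutator: the slot symmetries come from
`…B12Schur433.hessian_chart_symm` and `…B12WardThird415.fderiv_fderiv_fderiv_apply_swap_left/right`, the
identities (4.15) from `wt_chart_of_bracket`.  Pointwise in `x` (dictionary (i)); `c = ∂λ_x` with `c(x) = B(x)`
(dictionary (iv)); the eleven remainder terms are print's «irrelevant terms» (NOT bounded here).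
[cite: Balaban1987RG1, (4.21) p.285, (4.23) p.286, (4.24)-(4.27) p.287, (4.28)-(4.29) p.288] -/
theorem eq429_chart_of_bracket {ℰ : (Λ → T → 𝔄) → F} (e : Λ → T) (ρ : V →L[ℝ] 𝔄) (hℰ : ContDiffAt ℝ 4 ℰ 1)
    (h47 : ∀ lam : T → V, ∀ᶠ W in 𝓝 (1 : Λ → T → 𝔄), ∀ᶠ t in 𝓝 (0 : ℝ),
      ℰ (fun ν x => exp (t • ρ (lam x)) * W ν x * exp (-(t • ρ (lam (x + e ν))))) = ℰ W)
    (br : V →ₗ[ℝ] V →ₗ[ℝ] V) (hbr : ∀ a b, ρ (br a b) = ρ a * ρ b - ρ b * ρ a) (hself : ∀ a, br a a = 0)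
    (hspan : Submodule.span ℝ {c : V | ∃ l v : V, ρ c = ρ l * ρ v - ρ v * ρ l} = ⊤)
    (x : T) (lam : T → V) (hlam : lam x = 0) (δ c B : Λ → T → V)
    (hδ : ∀ ν y, y ≠ x → δ ν y = 0) (hc : ∀ ν y, lam (y + e ν) - lam y = c ν y) (hB : ∀ ν, B ν x = c ν x) :
    fderiv ℝ (fderiv ℝ (fderiv ℝ (fderiv ℝ (fun A : Λ → T → V => ℰ (fun ν y => exp (ρ (A ν y))))))) 0 δ B B B =
      (2 : ℝ) • fderiv ℝ (fderiv ℝ (fun A : Λ → T → V => ℰ (fun ν y => exp (ρ (A ν y))))) 0 δ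
          (fun ν y => br (lam y) (br (lam y) (c ν y)))
      - fderiv ℝ (fderiv ℝ (fun A : Λ → T → V => ℰ (fun ν y => exp (ρ (A ν y))))) 0 δ
          (fun ν y => br (br (lam y) (c ν y)) (c ν y))
      - (3 / 2 : ℝ) • fderiv ℝ (fderiv ℝ (fun A : Λ → T → V => ℰ (fun ν y => exp (ρ (A ν y))))) 0
          (fun ν y => br (δ ν y) (B ν y)) (fun ν y => br (lam y) (c ν y))
      + (fderiv ℝ (fderiv ℝ (fderiv ℝ (fderiv ℝ (fun A : Λ → T → V => ℰ (fun ν y => exp (ρ (A ν y))))))) 0 δ B B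
          (B - c)
        - (2 : ℝ) • fderiv ℝ (fderiv ℝ (fun A : Λ → T → V => ℰ (fun ν y => exp (ρ (A ν y))))) 0
            (fun ν y => (12 : ℝ)⁻¹ • (br (B ν y) (br (δ ν y) (c ν y))
            + br (δ ν y) (br (B ν y) (c ν y)))) (B - c)
        - (2 : ℝ) • fderiv ℝ (fderiv ℝ (fun A : Λ → T → V => ℰ (fun ν y => exp (ρ (A ν y))))) 0 δ
            (fun ν y => (12 : ℝ)⁻¹ • br (B ν y) (br (B ν y - c ν y) (c ν y)))
        - (2 : ℝ)⁻¹ • fderiv ℝ (fderiv ℝ (fderiv ℝ (fun A : Λ → T → V => ℰ (fun ν y => exp (ρ (A ν y)))))) 0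
            (fun ν y => br (δ ν y) (B ν y)) B (B - c)
        + (4 : ℝ)⁻¹ • fderiv ℝ (fderiv ℝ (fun A : Λ → T → V => ℰ (fun ν y => exp (ρ (A ν y))))) 0
            (fun ν y => br (δ ν y) (B ν y)) (fun ν y => br (B ν y - c ν y) (c ν y))
        + (4 : ℝ)⁻¹ • fderiv ℝ (fderiv ℝ (fun A : Λ → T → V => ℰ (fun ν y => exp (ρ (A ν y))))) 0
            (fun ν y => br (br (δ ν y) (B ν y)) (B ν y)) (B - c)
        - fderiv ℝ (fderiv ℝ (fderiv ℝ (fun A : Λ → T → V => ℰ (fun ν y => exp (ρ (A ν y)))))) 0 δ B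
            (fun ν y => br (B ν y - c ν y) (c ν y))
        + (2 : ℝ) • fderiv ℝ (fderiv ℝ (fderiv ℝ (fun A : Λ → T → V => ℰ (fun ν y => exp (ρ (A ν y)))))) 0 δ
            (fun ν y => br (lam y) (B ν y)) (B - c)
        + (2 : ℝ) • fderiv ℝ (fderiv ℝ (fun A : Λ → T → V => ℰ (fun ν y => exp (ρ (A ν y))))) 0 δ
            (fun ν y => br (lam y) (br (lam y) (B ν y - c ν y)))
        - fderiv ℝ (fderiv ℝ (fun A : Λ → T → V => ℰ (fun ν y => exp (ρ (A ν y))))) 0 δ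
            (fun ν y => br (br (lam y) (B ν y - c ν y)) (c ν y))
        - (3 / 2 : ℝ) • fderiv ℝ (fderiv ℝ (fun A : Λ → T → V => ℰ (fun ν y => exp (ρ (A ν y))))) 0
            (fun ν y => br (δ ν y) (B ν y)) (fun ν y => br (lam y) (B ν y - c ν y))) := by
  have hf3 := contDiffAt_three_comp_chart (Λ := Λ) (T := T) ρ (hℰ.of_le (by norm_num))
  obtain ⟨h1, h2, h3⟩ := wt_chart_of_bracket e ρ hℰ h47 br hbr hspan lam c hc
  exact eq429 _ _ _ (fun u v => hessian_chart_symm ρ (hℰ.of_le (by norm_num)) u v)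
    (fun u v w => fderiv_fderiv_fderiv_apply_swap_left hf3 u v w)
    (fun u v w => fderiv_fderiv_fderiv_apply_swap_right hf3 u v w) br hself x lam hlam δ c B hδ hB h1 h2 h3


-- (the quadruply nested operator space over the iterated `Pi` type: one more level of pending instance synthesis)
set_option maxSynthPendingDepth 3 in
/-- **(4.7) + `C⁴` + «The group G is semisimple» ⇒ (4.29)** — `eq429_chart_of_bracket` for the charge space `V` a
finite-dimensional SEMISIMPLE real Lie algebra `𝔤` (any linear identification `eV`) represented in `𝔄` by `ρ`
(`hρ`), print's `i[·, ·]` the Lie bracket: every hypothesis of the abstract `eq429` is discharged except the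
analytic ones ((4.7) near `1` for all `𝔤`-valued gauge functions, `C⁴` at `1`); perfectness by name from
`…B12Semisimple414.span_commutatorSet_eq_top_of_isSemisimple`. [cite: Balaban1987RG1, (4.21) p.285, (4.23) p.286,
(4.24)-(4.27) p.287, (4.28)-(4.29) p.288] -/
theorem eq429_chart_of_isSemisimple {𝔤 : Type*} [LieRing 𝔤] [LieAlgebra ℝ 𝔤] [FiniteDimensional ℝ 𝔤]
    [LieAlgebra.IsSemisimple ℝ 𝔤] (eV : V ≃ₗ[ℝ] 𝔤) {ℰ : (Λ → T → 𝔄) → F} (e : Λ → T) (ρ : V →L[ℝ] 𝔄)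
    (hρ : ∀ a b : V, ρ (eV.symm ⁅eV a, eV b⁆) = ρ a * ρ b - ρ b * ρ a) (hℰ : ContDiffAt ℝ 4 ℰ 1)
    (h47 : ∀ lam : T → V, ∀ᶠ W in 𝓝 (1 : Λ → T → 𝔄), ∀ᶠ t in 𝓝 (0 : ℝ),
      ℰ (fun ν x => exp (t • ρ (lam x)) * W ν x * exp (-(t • ρ (lam (x + e ν))))) = ℰ W)
    (x : T) (lam : T → V) (hlam : lam x = 0) (δ c B : Λ → T → V)
    (hδ : ∀ ν y, y ≠ x → δ ν y = 0) (hc : ∀ ν y, lam (y + e ν) - lam y = c ν y) (hB : ∀ ν, B ν x = c ν x) :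
    fderiv ℝ (fderiv ℝ (fderiv ℝ (fderiv ℝ (fun A : Λ → T → V => ℰ (fun ν y => exp (ρ (A ν y))))))) 0 δ B B B =
      (2 : ℝ) • fderiv ℝ (fderiv ℝ (fun A : Λ → T → V => ℰ (fun ν y => exp (ρ (A ν y))))) 0 δ
          (fun ν y => eV.symm ⁅eV (lam y), eV (eV.symm ⁅eV (lam y), eV (c ν y)⁆)⁆)
      - fderiv ℝ (fderiv ℝ (fun A : Λ → T → V => ℰ (fun ν y => exp (ρ (A ν y))))) 0 δ
          (fun ν y => eV.symm ⁅eV (eV.symm ⁅eV (lam y), eV (c ν y)⁆), eV (c ν y)⁆)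
      - (3 / 2 : ℝ) • fderiv ℝ (fderiv ℝ (fun A : Λ → T → V => ℰ (fun ν y => exp (ρ (A ν y))))) 0
          (fun ν y => eV.symm ⁅eV (δ ν y), eV (B ν y)⁆) (fun ν y => eV.symm ⁅eV (lam y), eV (c ν y)⁆)
      + (fderiv ℝ (fderiv ℝ (fderiv ℝ (fderiv ℝ (fun A : Λ → T → V => ℰ (fun ν y => exp (ρ (A ν y))))))) 0 δ B B
          (B - c)
        - (2 : ℝ) • fderiv ℝ (fderiv ℝ (fun A : Λ → T → V => ℰ (fun ν y => exp (ρ (A ν y))))) 0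
            (fun ν y => (12 : ℝ)⁻¹ • (eV.symm ⁅eV (B ν y), eV (eV.symm ⁅eV (δ ν y), eV (c ν y)⁆)⁆
            + eV.symm ⁅eV (δ ν y), eV (eV.symm ⁅eV (B ν y), eV (c ν y)⁆)⁆)) (B - c)
        - (2 : ℝ) • fderiv ℝ (fderiv ℝ (fun A : Λ → T → V => ℰ (fun ν y => exp (ρ (A ν y))))) 0 δ
            (fun ν y => (12 : ℝ)⁻¹ • eV.symm ⁅eV (B ν y), eV (eV.symm ⁅eV (B ν y - c ν y), eV (c ν y)⁆)⁆)
        - (2 : ℝ)⁻¹ • fderiv ℝ (fderiv ℝ (fderiv ℝ (fun A : Λ → T → V => ℰ (fun ν y => exp (ρ (A ν y)))))) 0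
            (fun ν y => eV.symm ⁅eV (δ ν y), eV (B ν y)⁆) B (B - c)
        + (4 : ℝ)⁻¹ • fderiv ℝ (fderiv ℝ (fun A : Λ → T → V => ℰ (fun ν y => exp (ρ (A ν y))))) 0
            (fun ν y => eV.symm ⁅eV (δ ν y), eV (B ν y)⁆) (fun ν y => eV.symm ⁅eV (B ν y - c ν y), eV (c ν y)⁆)
        + (4 : ℝ)⁻¹ • fderiv ℝ (fderiv ℝ (fun A : Λ → T → V => ℰ (fun ν y => exp (ρ (A ν y))))) 0
            (fun ν y => eV.symm ⁅eV (eV.symm ⁅eV (δ ν y), eV (B ν y)⁆), eV (B ν y)⁆) (B - c)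
        - fderiv ℝ (fderiv ℝ (fderiv ℝ (fun A : Λ → T → V => ℰ (fun ν y => exp (ρ (A ν y)))))) 0 δ B
            (fun ν y => eV.symm ⁅eV (B ν y - c ν y), eV (c ν y)⁆)
        + (2 : ℝ) • fderiv ℝ (fderiv ℝ (fderiv ℝ (fun A : Λ → T → V => ℰ (fun ν y => exp (ρ (A ν y)))))) 0 δ
            (fun ν y => eV.symm ⁅eV (lam y), eV (B ν y)⁆) (B - c)
        + (2 : ℝ) • fderiv ℝ (fderiv ℝ (fun A : Λ → T → V => ℰ (fun ν y => exp (ρ (A ν y))))) 0 δ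
            (fun ν y => eV.symm ⁅eV (lam y), eV (eV.symm ⁅eV (lam y), eV (B ν y - c ν y)⁆)⁆)
        - fderiv ℝ (fderiv ℝ (fun A : Λ → T → V => ℰ (fun ν y => exp (ρ (A ν y))))) 0 δ
            (fun ν y => eV.symm ⁅eV (eV.symm ⁅eV (lam y), eV (B ν y - c ν y)⁆), eV (c ν y)⁆)
        - (3 / 2 : ℝ) • fderiv ℝ (fderiv ℝ (fun A : Λ → T → V => ℰ (fun ν y => exp (ρ (A ν y))))) 0
            (fun ν y => eV.symm ⁅eV (δ ν y), eV (B ν y)⁆) (fun ν y => eV.symm ⁅eV (lam y), eV (B ν y - c ν y)⁆)) := by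
  simpa only [LinearMap.mk₂_apply] using eq429_chart_of_bracket e ρ hℰ h47
    (LinearMap.mk₂ ℝ (fun a b => eV.symm ⁅eV a, eV b⁆) (fun _ _ _ => by simp) (fun _ _ _ => by simp)
      (fun _ _ _ => by simp) (fun _ _ _ => by simp)) hρ (fun a => by simp)
    (span_commutatorSet_eq_top_of_isSemisimple eV ρ hρ) x lam hlam δ c B hδ hc hB


-- (the quadruply nested operator space over the iterated `Pi` type: one more level of pending instance synthesis)
set_option maxSynthPendingDepth 3 in
/-- **(4.29) at `B = B(x)` in the chart, `𝔤` semisimple** — `eq429_atPoint` discharged as in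
`eq429_chart_of_isSemisimple`: for a field `c = ∂λ_x` (`λ_x(x) = 0`) and a one-site `δB`,
`D⁴f(0)(δB, c, c, c) = 2D²f(0)(δB, [λ_x,[λ_x,c]]) − D²f(0)(δB, [[λ_x,c],c]) − (3/2)D²f(0)([δB,c], [λ_x,c])` — print's
(4.29) with no irrelevant terms when `B` coincides with its value at the point `x`.
[cite: Balaban1987RG1, (4.29) p.288] -/
theorem eq429_atPoint_chart_of_isSemisimple {𝔤 : Type*} [LieRing 𝔤] [LieAlgebra ℝ 𝔤] [FiniteDimensional ℝ 𝔤]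
    [LieAlgebra.IsSemisimple ℝ 𝔤] (eV : V ≃ₗ[ℝ] 𝔤) {ℰ : (Λ → T → 𝔄) → F} (e : Λ → T) (ρ : V →L[ℝ] 𝔄)
    (hρ : ∀ a b : V, ρ (eV.symm ⁅eV a, eV b⁆) = ρ a * ρ b - ρ b * ρ a) (hℰ : ContDiffAt ℝ 4 ℰ 1)
    (h47 : ∀ lam : T → V, ∀ᶠ W in 𝓝 (1 : Λ → T → 𝔄), ∀ᶠ t in 𝓝 (0 : ℝ),
      ℰ (fun ν x => exp (t • ρ (lam x)) * W ν x * exp (-(t • ρ (lam (x + e ν))))) = ℰ W)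
    (x : T) (lam : T → V) (hlam : lam x = 0) (δ c : Λ → T → V)
    (hδ : ∀ ν y, y ≠ x → δ ν y = 0) (hc : ∀ ν y, lam (y + e ν) - lam y = c ν y) :
    fderiv ℝ (fderiv ℝ (fderiv ℝ (fderiv ℝ (fun A : Λ → T → V => ℰ (fun ν y => exp (ρ (A ν y))))))) 0 δ c c c =
      (2 : ℝ) • fderiv ℝ (fderiv ℝ (fun A : Λ → T → V => ℰ (fun ν y => exp (ρ (A ν y))))) 0 δ
          (fun ν y => eV.symm ⁅eV (lam y), eV (eV.symm ⁅eV (lam y), eV (c ν y)⁆)⁆)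
      - fderiv ℝ (fderiv ℝ (fun A : Λ → T → V => ℰ (fun ν y => exp (ρ (A ν y))))) 0 δ
          (fun ν y => eV.symm ⁅eV (eV.symm ⁅eV (lam y), eV (c ν y)⁆), eV (c ν y)⁆)
      - (3 / 2 : ℝ) • fderiv ℝ (fderiv ℝ (fun A : Λ → T → V => ℰ (fun ν y => exp (ρ (A ν y))))) 0
          (fun ν y => eV.symm ⁅eV (δ ν y), eV (c ν y)⁆) (fun ν y => eV.symm ⁅eV (lam y), eV (c ν y)⁆) := by
  have hf3 := contDiffAt_three_comp_chart (Λ := Λ) (T := T) ρ (hℰ.of_le (by norm_num))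
  have hρ' : ∀ a b, ρ (LinearMap.mk₂ ℝ (fun a b => eV.symm ⁅eV a, eV b⁆) (fun _ _ _ => by simp)
      (fun _ _ _ => by simp) (fun _ _ _ => by simp) (fun _ _ _ => by simp) a b) = ρ a * ρ b - ρ b * ρ a :=
    fun a b => by simpa only [LinearMap.mk₂_apply] using hρ a b
  obtain ⟨h1, h2, h3⟩ := wt_chart_of_bracket e ρ hℰ h47 _ hρ' (span_commutatorSet_eq_top_of_isSemisimple eV ρ hρ)
    lam c hc
  simpa only [LinearMap.mk₂_apply] using eq429_atPoint _ _ _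
    (fun u v => hessian_chart_symm ρ (hℰ.of_le (by norm_num)) u v)
    (fun u v w => fderiv_fderiv_fderiv_apply_swap_left hf3 u v w)
    (fun u v w => fderiv_fderiv_fderiv_apply_swap_right hf3 u v w) _ (fun a => by simp) x lam hlam δ c hδ h1 h2 h3


/-- **(4.31) in the chart, from (4.7), `C³`-smoothness and perfectness** — `eq431` for `E2, E3` the second and third
derivatives at `B = 0` of `f(B) = 𝐄(exp ρB)`, any alternating bilinear `br` represented by the commutator; `ℓ` is
print's `B(·, x)` (arbitrary here), `B − c − ℓ` its second-order Taylor remainder; the six remainder terms are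
print's «irrelevant terms» (NOT bounded here). [cite: Balaban1987RG1, (4.30) p.288, (4.31) p.289] -/
theorem eq431_chart_of_bracket {ℰ : (Λ → T → 𝔄) → F} (e : Λ → T) (ρ : V →L[ℝ] 𝔄) (hℰ : ContDiffAt ℝ 3 ℰ 1)
    (h47 : ∀ lam : T → V, ∀ᶠ W in 𝓝 (1 : Λ → T → 𝔄), ∀ᶠ t in 𝓝 (0 : ℝ),
      ℰ (fun ν x => exp (t • ρ (lam x)) * W ν x * exp (-(t • ρ (lam (x + e ν))))) = ℰ W)
    (br : V →ₗ[ℝ] V →ₗ[ℝ] V) (hbr : ∀ a b, ρ (br a b) = ρ a * ρ b - ρ b * ρ a) (hself : ∀ a, br a a = 0)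
    (hspan : Submodule.span ℝ {c : V | ∃ l v : V, ρ c = ρ l * ρ v - ρ v * ρ l} = ⊤)
    (x : T) (lam : T → V) (hlam : lam x = 0) (δ c B ℓ : Λ → T → V)
    (hδ : ∀ ν y, y ≠ x → δ ν y = 0) (hc : ∀ ν y, lam (y + e ν) - lam y = c ν y) (hB : ∀ ν, B ν x = c ν x) :
    fderiv ℝ (fderiv ℝ (fderiv ℝ (fun A : Λ → T → V => ℰ (fun ν y => exp (ρ (A ν y)))))) 0 δ B B =
      fderiv ℝ (fderiv ℝ (fun A : Λ → T → V => ℰ (fun ν y => exp (ρ (A ν y))))) 0 δ (fun ν y => br (lam y) (c ν y))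
      + (2 : ℝ) • fderiv ℝ (fderiv ℝ (fun A : Λ → T → V => ℰ (fun ν y => exp (ρ (A ν y))))) 0 δ
          (fun ν y => br (lam y) (ℓ ν y))
      - fderiv ℝ (fderiv ℝ (fun A : Λ → T → V => ℰ (fun ν y => exp (ρ (A ν y))))) 0 δ
          (fun ν y => br (ℓ ν y) (c ν y))
      - fderiv ℝ (fderiv ℝ (fun A : Λ → T → V => ℰ (fun ν y => exp (ρ (A ν y))))) 0
          (fun ν y => br (δ ν y) (B ν y)) ℓ
      + (fderiv ℝ (fderiv ℝ (fderiv ℝ (fun A : Λ → T → V => ℰ (fun ν y => exp (ρ (A ν y)))))) 0 δ B (B - c - ℓ)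
        + fderiv ℝ (fderiv ℝ (fderiv ℝ (fun A : Λ → T → V => ℰ (fun ν y => exp (ρ (A ν y)))))) 0 δ ℓ ℓ
        + fderiv ℝ (fderiv ℝ (fderiv ℝ (fun A : Λ → T → V => ℰ (fun ν y => exp (ρ (A ν y)))))) 0 δ (B - c - ℓ) ℓ
        - (2 : ℝ)⁻¹ • fderiv ℝ (fderiv ℝ (fun A : Λ → T → V => ℰ (fun ν y => exp (ρ (A ν y))))) 0
            (fun ν y => br (δ ν y) (B ν y)) (B - c - ℓ)
        + fderiv ℝ (fderiv ℝ (fun A : Λ → T → V => ℰ (fun ν y => exp (ρ (A ν y))))) 0 δ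
            (fun ν y => br (lam y) (B ν y - c ν y - ℓ ν y))
        - (2 : ℝ)⁻¹ • fderiv ℝ (fderiv ℝ (fun A : Λ → T → V => ℰ (fun ν y => exp (ρ (A ν y))))) 0 δ
            (fun ν y => br (B ν y - c ν y - ℓ ν y) (c ν y))) := by
  have hf3 := contDiffAt_three_comp_chart (Λ := Λ) (T := T) ρ hℰ
  obtain ⟨h1, h2⟩ := wt12_chart_of_bracket e ρ hℰ h47 br hbr hspan lam c hc
  exact eq431 _ _ (fun u v => hessian_chart_symm ρ hℰ u v)
    (fun u v w => fderiv_fderiv_fderiv_apply_swap_right hf3 u v w) br hself x lam hlam δ c B ℓ hδ hB h1 h2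


/-- **(4.7) + `C³` + «The group G is semisimple» ⇒ (4.31)** — `eq431_chart_of_bracket` for `V ≃ 𝔤` finite-dimensional
semisimple, `ρ` a representation, print's `i[·, ·]` the Lie bracket. [cite: Balaban1987RG1, (4.30) p.288, (4.31)
p.289] -/
theorem eq431_chart_of_isSemisimple {𝔤 : Type*} [LieRing 𝔤] [LieAlgebra ℝ 𝔤] [FiniteDimensional ℝ 𝔤]
    [LieAlgebra.IsSemisimple ℝ 𝔤] (eV : V ≃ₗ[ℝ] 𝔤) {ℰ : (Λ → T → 𝔄) → F} (e : Λ → T) (ρ : V →L[ℝ] 𝔄)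
    (hρ : ∀ a b : V, ρ (eV.symm ⁅eV a, eV b⁆) = ρ a * ρ b - ρ b * ρ a) (hℰ : ContDiffAt ℝ 3 ℰ 1)
    (h47 : ∀ lam : T → V, ∀ᶠ W in 𝓝 (1 : Λ → T → 𝔄), ∀ᶠ t in 𝓝 (0 : ℝ),
      ℰ (fun ν x => exp (t • ρ (lam x)) * W ν x * exp (-(t • ρ (lam (x + e ν))))) = ℰ W)
    (x : T) (lam : T → V) (hlam : lam x = 0) (δ c B ℓ : Λ → T → V)
    (hδ : ∀ ν y, y ≠ x → δ ν y = 0) (hc : ∀ ν y, lam (y + e ν) - lam y = c ν y) (hB : ∀ ν, B ν x = c ν x) :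
    fderiv ℝ (fderiv ℝ (fderiv ℝ (fun A : Λ → T → V => ℰ (fun ν y => exp (ρ (A ν y)))))) 0 δ B B =
      fderiv ℝ (fderiv ℝ (fun A : Λ → T → V => ℰ (fun ν y => exp (ρ (A ν y))))) 0 δ
          (fun ν y => eV.symm ⁅eV (lam y), eV (c ν y)⁆)
      + (2 : ℝ) • fderiv ℝ (fderiv ℝ (fun A : Λ → T → V => ℰ (fun ν y => exp (ρ (A ν y))))) 0 δ
          (fun ν y => eV.symm ⁅eV (lam y), eV (ℓ ν y)⁆)
      - fderiv ℝ (fderiv ℝ (fun A : Λ → T → V => ℰ (fun ν y => exp (ρ (A ν y))))) 0 δ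
          (fun ν y => eV.symm ⁅eV (ℓ ν y), eV (c ν y)⁆)
      - fderiv ℝ (fderiv ℝ (fun A : Λ → T → V => ℰ (fun ν y => exp (ρ (A ν y))))) 0
          (fun ν y => eV.symm ⁅eV (δ ν y), eV (B ν y)⁆) ℓ
      + (fderiv ℝ (fderiv ℝ (fderiv ℝ (fun A : Λ → T → V => ℰ (fun ν y => exp (ρ (A ν y)))))) 0 δ B (B - c - ℓ)
        + fderiv ℝ (fderiv ℝ (fderiv ℝ (fun A : Λ → T → V => ℰ (fun ν y => exp (ρ (A ν y)))))) 0 δ ℓ ℓ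
        + fderiv ℝ (fderiv ℝ (fderiv ℝ (fun A : Λ → T → V => ℰ (fun ν y => exp (ρ (A ν y)))))) 0 δ (B - c - ℓ) ℓ
        - (2 : ℝ)⁻¹ • fderiv ℝ (fderiv ℝ (fun A : Λ → T → V => ℰ (fun ν y => exp (ρ (A ν y))))) 0
            (fun ν y => eV.symm ⁅eV (δ ν y), eV (B ν y)⁆) (B - c - ℓ)
        + fderiv ℝ (fderiv ℝ (fun A : Λ → T → V => ℰ (fun ν y => exp (ρ (A ν y))))) 0 δ
            (fun ν y => eV.symm ⁅eV (lam y), eV (B ν y - c ν y - ℓ ν y)⁆)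
        - (2 : ℝ)⁻¹ • fderiv ℝ (fderiv ℝ (fun A : Λ → T → V => ℰ (fun ν y => exp (ρ (A ν y))))) 0 δ
            (fun ν y => eV.symm ⁅eV (B ν y - c ν y - ℓ ν y), eV (c ν y)⁆)) := by
  simpa only [LinearMap.mk₂_apply] using eq431_chart_of_bracket e ρ hℰ h47
    (LinearMap.mk₂ ℝ (fun a b => eV.symm ⁅eV a, eV b⁆) (fun _ _ _ => by simp) (fun _ _ _ => by simp)
      (fun _ _ _ => by simp) (fun _ _ _ => by simp)) hρ (fun a => by simp)
    (span_commutatorSet_eq_top_of_isSemisimple eV ρ hρ) x lam hlam δ c B ℓ hδ hc hB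


end Chart
end Literature.MathematicalPhysics.QuantumFieldTheory.Balaban1983to89.B12WTReduction429
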